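import Literature.Analysis.FluidPDE.LeraySuitableWeakSolutions
import Literature.Analysis.FluidPDE.UlocSolenoidalSplitting
import Literature.Analysis.FluidPDE.UlocKatoRegularFlow
import Literature.Analysis.FluidPDE.PerturbedEnergyGronwall
import Literature.Analysis.FluidPDE.LocalEnergyLimitInitialTools
import Literature.Analysis.FluidPDE.NSSereginLimitingProcedureHolds
import Literature.Analysis.FluidPDE.NSSereginLimitDecayHolds
import Literature.Analysis.FluidPDE.LocalLerayPressureBoundHolds
import Literature.Analysis.FluidPDE.LocalLerayPressureBoundTools
import Literature.Analysis.FluidPDE.JiaSverak2013Lemma8SliceTools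
import Literature.Analysis.FluidPDE.LerayHopfMild
import Literature.Analysis.FluidPDE.LocalLerayLimitWeakContinuity
import Literature.Analysis.FunctionSpaces.TestPairingLimits
import HarnessLib

/-!
# Unit-time existence of local energy solutions for `E̊₃` data (Lemarié-Rieusset 2016, Thm. 14.8,
# proof, Step 2; Seregin 2014, App. B §B.5)

Analysis/FluidPDE theorem file (no definitions, no named facts). Main result:
`localEnergySolution_exists_unit_of_memE3` — every measurable, weakly divergence-free datum `a`
with `sup_{x₀} ∫_{B(x₀,1)} |a|³ < ∞` and `∫_{B(x₀,1)} |a|³ → 0` (`|x₀| → ∞`) is the datum of a local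
energy solution of the unit-viscosity Navier–Stokes equations on `ℝ³ × (0, 1)`
(`IsLocalEnergySolutionOn 1 1 a w q`). This is hypothesis (h₂) of
`localEnergySolution_extension_of_memE2_of_unitExistence` (`LocalEnergyExtension.lean`), i.e. the
last missing step of the named fact `localEnergySolution_extension_of_memE2` (**F2**).

## The proof (Lemarié-Rieusset 2016, pp. 521–526; Seregin 2014, pp. 165–166, with the weak
## solution `u₂` constructed by Leray's scheme and compactness)

1. *Splitting of the datum* (`exists_uloc_solenoidal_splitting`): `a ← a_k = α_k + β_k`,
   divergence-free fields in `L² ∩ L³ ∩ L^∞`, `α_k` uniformly small in `L³_uloc`, `β_k` bounded in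
   `L²`, `a_k → a` in `L²_loc`.
2. *The approximants*: `v_k` = Leray's weak solution from `a_k`
   (`exists_isGlobalLerayHopf_and_isLocalEnergySolutionOn`: a global Leray–Hopf solution which is a
   local energy solution on every slab); `a¹_k` = the uniformly local small-data mild solution from
   `α_k` (`exists_uloc_regular_flow`); `w_k = v_k − a¹_k`.
3. *A priori bounds uniform in `k`*: the perturbed energy inequality with Grönwall
   (`exists_perturbed_energy_gronwall`: `‖w_k(s)‖₂² ≤ ‖β_k‖₂² eˢ`, `∫∫|∇w_k|² ≤ ‖β_k‖₂²(1 + 2e²)`)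
   and the uniform bounds of the regular flow give `sup_t sup_{x₀} ∫_{B(x₀,1)} |v_k(t)|² ≤ C`,
   `sup_{x₀} ∫₀^{3/2}∫_{B(x₀,1)} |∇v_k|² ≤ C`.
4. *The limiting procedure* (`seregin2014_localEnergy_limitingProcedure_holds`) on `[0, 3/2]`,
   the identification of the datum `u(0) = a` (pairings), the weak continuity, the pressure
   expansion and the decay of the limit (`seregin2014_limit_decay_holds`) — as in the tree's
   `lemarieRieusset_localLeray_compactness_of_parts`.
5. *The initial condition* `∫_K |u(t) − a|² → 0` (Kikuchi–Seregin 2007, proof of Thm. 1.4): the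
   local energy inequality from `t = 0` with a Kang–Miura–Tsai gauge gives
   `∫|v_k(t)|²ψ ≤ ∫|a_k|²ψ + ρ(2t)` for every small `t`, uniformly in `k` (`ρ(σ) → 0`); weak lower
   semicontinuity passes it to `u`; with the weak continuity at `0` against `ψ a ∈ L²`,
   `∫|u(t) − a|²ψ ≤ 2(∫|a|²ψ − ∫⟪u(t), ψa⟫) + ρ(2t) → 0` (`LocalEnergyLimitInitialTools.lean`).

## References

* P. G. Lemarié-Rieusset, *The Navier–Stokes Problem in the 21st Century* (2016), Thm. 14.8,
  proof, Steps 2–3 (PDF pp. 521–527).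
* G. Seregin, *Lecture Notes on Regularity Theory for the Navier–Stokes Equations* (2014), App. B,
  §B.5 (Thms. 5.9–5.11, (B.5.4)–(B.5.9)), §B.4.
* N. Kikuchi, G. Seregin, AMS Transl. (2) 220 (2007), §5 and proof of Thm. 1.4.
-/

noncomputable section

open MeasureTheory TopologicalSpace Set Function Filter Metric
open _root_.Topology
open scoped ENNReal NNReal RealInnerProductSpace Laplacian

namespace Literature.Analysis.FluidPDE

/-! ### Small tools -/

/-- `E̊₃ ⊂ E̊₂`: uniformly locally `L³` data vanishing at infinity are in Lemarié-Rieusset's class `E²`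
(Hölder on unit balls). [folklore] -/
theorem memE2_of_uloc_cube {a : EuclideanSpace ℝ (Fin 3) → EuclideanSpace ℝ (Fin 3)}
    (ham : AEStronglyMeasurable a volume) {A : ℝ≥0}
    (hA : ∀ x₀ : EuclideanSpace ℝ (Fin 3), ∫⁻ x in ball x₀ 1, ‖a x‖ₑ ^ (3 : ℕ) ≤ A)
    (hdecay : Tendsto (fun x₀ : EuclideanSpace ℝ (Fin 3) => ∫⁻ x in ball x₀ 1, ‖a x‖ₑ ^ (3 : ℕ))
      (cocompact (EuclideanSpace ℝ (Fin 3))) (𝓝 0)) :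
    MemE2 a := by
  set V : ℝ≥0∞ := volume (ball (0 : EuclideanSpace ℝ (Fin 3)) 1) with hV
  have hVt : V ≠ ⊤ := measure_ball_lt_top.ne
  have hsq : ∀ x₀ : EuclideanSpace ℝ (Fin 3), ∫⁻ x in ball x₀ 1, ‖a x‖ₑ ^ 2 ≤
      V ^ (1 / 3 : ℝ) * (∫⁻ x in ball x₀ 1, ‖a x‖ₑ ^ (3 : ℕ)) ^ (2 / 3 : ℝ) := fun x₀ =>
    lintegral_unitBall_sq_le_rpow_cube ham.enorm x₀
  set B : ℝ≥0∞ := V ^ (1 / 3 : ℝ) * (A : ℝ≥0∞) ^ (2 / 3 : ℝ) with hB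
  have hBt : B ≠ ⊤ := ENNReal.mul_ne_top (ENNReal.rpow_ne_top_of_nonneg (by norm_num) hVt)
    (ENNReal.rpow_ne_top_of_nonneg (by norm_num) ENNReal.coe_ne_top)
  refine ⟨ham, ⟨B.toNNReal, fun x₀ => ?_⟩, ?_⟩
  · rw [ENNReal.coe_toNNReal hBt]
    exact (hsq x₀).trans (mul_le_mul' le_rfl (ENNReal.rpow_le_rpow (hA x₀) (by norm_num)))
  · have h1 : Tendsto (fun x₀ : EuclideanSpace ℝ (Fin 3) => V ^ (1 / 3 : ℝ) * (∫⁻ x in ball x₀ 1, ‖a x‖ₑ ^ (3 : ℕ)) ^ (2 / 3 : ℝ))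
        (cocompact (EuclideanSpace ℝ (Fin 3))) (𝓝 0) := by
      have h := ((ENNReal.continuous_rpow_const (y := (2 / 3 : ℝ))).tendsto 0).comp hdecay
      rw [ENNReal.zero_rpow_of_pos (by norm_num)] at h
      have h' := ENNReal.Tendsto.const_mul h (a := V ^ (1 / 3 : ℝ)) (Or.inr (ENNReal.rpow_ne_top_of_nonneg (by norm_num) hVt))
      rwa [mul_zero] at h'
    exact tendsto_of_tendsto_of_tendsto_of_le_of_le tendsto_const_nhds h1 (fun _ => zero_le) hsq

/-- `‖θ • w‖ₑ² = ofReal (‖w‖² θ²)`. [folklore] -/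
theorem enorm_real_smul_sq_eq_ofReal (θ : ℝ) (w : EuclideanSpace ℝ (Fin 3)) :
    ‖θ • w‖ₑ ^ 2 = ENNReal.ofReal (‖w‖ ^ 2 * θ ^ 2) := by
  rw [← ofReal_norm, ← ENNReal.ofReal_pow (norm_nonneg _), norm_smul, mul_pow, Real.norm_eq_abs, sq_abs, mul_comm]

/-- The weighted energy as a lower integral: `∫⁻ ‖θ w‖ₑ² = ofReal ∫ ‖w‖² θ²` for integrable
`‖w‖² θ²`. [folklore] -/
theorem lintegral_enorm_smul_sq_eq_ofReal_integral {w : EuclideanSpace ℝ (Fin 3) → EuclideanSpace ℝ (Fin 3)}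
    {θ : EuclideanSpace ℝ (Fin 3) → ℝ} (hint : Integrable (fun x => ‖w x‖ ^ 2 * θ x ^ 2) volume) :
    ∫⁻ x, ‖θ x • w x‖ₑ ^ 2 = ENNReal.ofReal (∫ x, ‖w x‖ ^ 2 * θ x ^ 2) := by
  rw [ofReal_integral_eq_lintegral_ofReal hint (ae_of_all _ fun x => mul_nonneg (sq_nonneg _) (sq_nonneg _))]
  exact lintegral_congr fun x => enorm_real_smul_sq_eq_ofReal _ _

/-- A function of time which holds a.e. on `(0,T)` holds a.e. on every product `(0,T) × S`.
[folklore] -/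
theorem ae_restrict_prod_of_ae_restrict {T : ℝ} {P : ℝ → Prop} (h : ∀ᵐ t ∂(volume.restrict (Ioo (0 : ℝ) T)), P t)
    (S : Set (EuclideanSpace ℝ (Fin 3))) :
    ∀ᵐ z ∂(volume.restrict (Ioo (0 : ℝ) T ×ˢ S)), P z.1 := by
  have h1 : ∀ᵐ z ∂((volume.restrict (Ioo (0 : ℝ) T)).prod (volume : Measure (EuclideanSpace ℝ (Fin 3)))), P z.1 :=
    (Measure.quasiMeasurePreserving_fst (μ := volume.restrict (Ioo (0 : ℝ) T))
      (ν := (volume : Measure (EuclideanSpace ℝ (Fin 3))))).tendsto_ae.eventually h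
  rw [← volume_restrict_slab_eq_prod] at h1
  exact ae_mono (Measure.restrict_mono (Set.prod_mono Subset.rfl (subset_univ _)) le_rfl) h1

/-! ### The convergence of pairings of the data -/

/-- **Strong `L²_loc` convergence gives convergence of the pairings with test fields.** [folklore] -/
theorem tendsto_integral_inner_of_tendsto_lintegral_ball {a : ℕ → EuclideanSpace ℝ (Fin 3) → EuclideanSpace ℝ (Fin 3)}
    {aL : EuclideanSpace ℝ (Fin 3) → EuclideanSpace ℝ (Fin 3)}
    (hloc : ∀ k (ρ : ℝ), MemLp (a k) 2 (volume.restrict (ball (0 : EuclideanSpace ℝ (Fin 3)) ρ)))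
    (hlocL : ∀ ρ : ℝ, MemLp aL 2 (volume.restrict (ball (0 : EuclideanSpace ℝ (Fin 3)) ρ)))
    (hconv : ∀ ρ : ℝ, 0 < ρ → Tendsto (fun k => ∫⁻ x in ball (0 : EuclideanSpace ℝ (Fin 3)) ρ,
      ‖a k x - aL x‖ₑ ^ (2 : ℕ)) atTop (𝓝 0))
    {ψ : EuclideanSpace ℝ (Fin 3) → EuclideanSpace ℝ (Fin 3)}
    (hψ : FunctionSpaces.IsTestFunctionOn (⊤ : Opens (EuclideanSpace ℝ (Fin 3))) ψ) :
    Tendsto (fun k => ∫ x, ⟪a k x, ψ x⟫) atTop (𝓝 (∫ x, ⟪aL x, ψ x⟫)) := by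
  obtain ⟨ρ, hρ0, hρ⟩ : ∃ ρ : ℝ, 0 < ρ ∧ tsupport ψ ⊆ ball (0 : EuclideanSpace ℝ (Fin 3)) ρ := by
    obtain ⟨ρ, hρ⟩ := hψ.hasCompactSupport.isBounded.subset_ball (0 : EuclideanSpace ℝ (Fin 3))
    exact ⟨max ρ 1, by positivity, hρ.trans (ball_subset_ball (le_max_left _ _))⟩
  set μB : Measure (EuclideanSpace ℝ (Fin 3)) := volume.restrict (ball (0 : EuclideanSpace ℝ (Fin 3)) ρ) with hμB
  have hψ2 : MemLp ψ 2 volume := hψ.contDiff.continuous.memLp_of_hasCompactSupport hψ.hasCompactSupport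
  have hvan : ∀ x, x ∉ ball (0 : EuclideanSpace ℝ (Fin 3)) ρ → ψ x = 0 := fun x hx =>
    image_eq_zero_of_notMem_tsupport fun h => hx (hρ h)
  -- `∫⟪a_k − aL, ψ⟫ = ∫_B ⟪a_k − aL, ψ⟫`, bounded by `‖a_k − aL‖_{L²(B)} ‖ψ‖_{L²(B)}`
  have hdiff : ∀ k, |(∫ x, ⟪a k x, ψ x⟫) - ∫ x, ⟪aL x, ψ x⟫| ≤
      (eLpNorm (fun x => a k x - aL x) 2 μB).toReal * (eLpNorm ψ 2 μB).toReal := by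
    intro k
    have hint : ∀ {f : EuclideanSpace ℝ (Fin 3) → EuclideanSpace ℝ (Fin 3)}, (∀ ρ : ℝ, MemLp f 2 (volume.restrict (ball 0 ρ))) →
        Integrable (fun x => ⟪f x, ψ x⟫) volume := by
      intro f hf
      have h1 : Integrable (fun x => ⟪f x, ψ x⟫) μB := integrable_inner_of_memLp_two (hf ρ) (hψ2.restrict _)
      refine (integrableOn_iff_integrable_of_support_subset (s := ball (0 : EuclideanSpace ℝ (Fin 3)) ρ) ?_).1 h1
      intro x hx
      by_contra hxB
      exact hx (by simp [hvan x hxB])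
    rw [← integral_sub (hint (hloc k)) (hint hlocL)]
    have e1 : ∫ x, (⟪a k x, ψ x⟫ - ⟪aL x, ψ x⟫) = ∫ x, ⟪a k x - aL x, ψ x⟫ :=
      integral_congr_ae (Eventually.of_forall fun x => by simp only [inner_sub_left])
    have e2 : ∫ x, ⟪a k x - aL x, ψ x⟫ = ∫ x in ball (0 : EuclideanSpace ℝ (Fin 3)) ρ, ⟪a k x - aL x, ψ x⟫ := by
      refine (setIntegral_eq_integral_of_forall_compl_eq_zero fun x hx => ?_).symm
      rw [hvan x hx, inner_zero_right]
    rw [e1, e2]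
    exact abs_integral_inner_le_of_memLp_two ((hloc k ρ).sub (hlocL ρ)) (hψ2.restrict _)
  -- the right-hand side tends to `0`
  have hnorm : Tendsto (fun k => (eLpNorm (fun x => a k x - aL x) 2 μB).toReal * (eLpNorm ψ 2 μB).toReal) atTop (𝓝 0) := by
    have h1 : Tendsto (fun k => eLpNorm (fun x => a k x - aL x) 2 μB) atTop (𝓝 0) := by
      have h := hconv ρ hρ0
      have e : ∀ k, eLpNorm (fun x => a k x - aL x) 2 μB = (∫⁻ x in ball (0 : EuclideanSpace ℝ (Fin 3)) ρ, ‖a k x - aL x‖ₑ ^ (2 : ℕ)) ^ (1 / 2 : ℝ) :=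
        fun k => eLpNorm_two_eq_rpow_lintegral_sq _ _
      simp_rw [e]
      have h' := ((ENNReal.continuous_rpow_const (y := (1 / 2 : ℝ))).tendsto 0).comp h
      rwa [ENNReal.zero_rpow_of_pos (by norm_num)] at h'
    have h2 : Tendsto (fun k => (eLpNorm (fun x => a k x - aL x) 2 μB).toReal) atTop (𝓝 0) := by
      have h := (ENNReal.tendsto_toReal ENNReal.zero_ne_top).comp h1
      rwa [ENNReal.toReal_zero] at h
    have h3 := h2.mul_const (eLpNorm ψ 2 μB).toReal
    rwa [zero_mul] at h3
  rw [tendsto_iff_norm_sub_tendsto_zero]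
  refine tendsto_of_tendsto_of_tendsto_of_le_of_le tendsto_const_nhds hnorm (fun k => norm_nonneg _) fun k => ?_
  rw [Real.norm_eq_abs]
  exact hdiff k

/-! ### The initial condition of the limit (Kikuchi–Seregin 2007, proof of Thm. 1.4) -/

/-- The weight `σ ↦ c₁ σ + c₂ σ^{1/4} + c₃ σ^{1/12}` (finite constants) tends to `0` as `σ → 0⁺`.
[folklore] -/
theorem tendsto_flux_modulus {c₁ c₂ c₃ : ℝ≥0∞} (h₁ : c₁ ≠ ⊤) (h₂ : c₂ ≠ ⊤) (h₃ : c₃ ≠ ⊤) :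
    Tendsto (fun σ : ℝ => c₁ * ENNReal.ofReal σ + c₂ * ENNReal.ofReal σ ^ (1 / 4 : ℝ) + c₃ * ENNReal.ofReal σ ^ (1 / 12 : ℝ))
      (𝓝[>] 0) (𝓝 0) := by
  have h0 : Tendsto (fun σ : ℝ => ENNReal.ofReal σ) (𝓝[>] 0) (𝓝 0) := by
    have h := (ENNReal.continuous_ofReal.tendsto 0).mono_left (nhdsWithin_le_nhds (s := Ioi (0 : ℝ)))
    rwa [ENNReal.ofReal_zero] at h
  have hp : ∀ {q : ℝ}, 0 < q → Tendsto (fun σ : ℝ => ENNReal.ofReal σ ^ q) (𝓝[>] 0) (𝓝 0) := fun {q} hq => by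
    have h := ((ENNReal.continuous_rpow_const (y := q)).tendsto 0).comp h0
    rwa [ENNReal.zero_rpow_of_pos hq] at h
  have t1 := ENNReal.Tendsto.const_mul h0 (a := c₁) (Or.inr h₁)
  have t2 := ENNReal.Tendsto.const_mul (hp (by norm_num : (0 : ℝ) < 1 / 4)) (a := c₂) (Or.inr h₂)
  have t3 := ENNReal.Tendsto.const_mul (hp (by norm_num : (0 : ℝ) < 1 / 12)) (a := c₃) (Or.inr h₃)
  rw [mul_zero] at t1 t2 t3
  simpa using (t1.add t2).add t3

set_option maxHeartbeats 12800000 in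
/-- **The initial condition of the limit, on a unit ball** (Kikuchi–Seregin 2007, proof of
Thm. 1.4; Seregin 2014, App. B §B.4 (B.4.17)–(B.4.20)). Let `(v_k, p_k)` be local energy solutions
on `ℝ³ × (0, T_ℓ)` with data `a_k ∈ L²_loc` (weakly divergence free), uniformly bounded: unit-ball
energies `≤ C_en` at a.e. time, weak gradients `G_k` with unit-cylinder bounds `≤ C_gr`, data with
unit-ball energies `≤ C_dat`; let `a_k → a` in `L²_loc`; let `u` be a family of slices on `[0, T]`,
`T ≤ T_ℓ`, measurable with unit-ball energies `≤ C`, weakly continuous against test fields, with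
`∫⟪v_{φ(k)}(t), ψ⟫ → ∫⟪u(t), ψ⟫` for every `t ∈ [0,T]` and every test field, and `u(0) = a` a.e.
Then `∫_{B(d,1)} |u(t) − a|² → 0` as `t → 0⁺`, for every centre `d`. Proof: with `ψ = θ²`,
`θ = χ₁(· − d)`: the local energy inequality from `t = 0` with a Kang–Miura–Tsai gauge and the
uniform bounds give `∫ |v_k(t)|²ψ ≤ ∫ |a_k|²ψ + ρ(σ)` for every `t ∈ (0,σ)`, `σ ≤ 1`, with
`ρ(σ) → 0` (`IsLocalEnergySolutionOn.integral_sq_mul_le_of_flux_le`); weak lower semicontinuity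
(`lintegral_sq_smul_le_of_tendsto_integral_inner`) gives `∫ |u(t)|²ψ ≤ ∫ |a|²ψ + ρ(σ)`; and
`∫⟪u(t), ψa⟫ → ∫ ψ|a|²` (`continuousOn_integral_inner_of_test_of_unitBall_bound`), so
`∫ |u(t) − a|²ψ ≤ 2(∫|a|²ψ − ∫⟪u(t), ψa⟫) + ρ(2t) → 0`. [cite: Seregin2014Notes, App. B §B.4 (B.4.17)–(B.4.20)] -/
theorem tendsto_lintegral_ball_sub_sq_of_uniform_bounds {Tℓ T : ℝ} (hT : 0 < T) (hTℓ : T ≤ Tℓ) (hT1 : 1 ≤ T)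
    {v : ℕ → ℝ → EuclideanSpace ℝ (Fin 3) → EuclideanSpace ℝ (Fin 3)} {p : ℕ → ℝ → EuclideanSpace ℝ (Fin 3) → ℝ}
    {ak : ℕ → EuclideanSpace ℝ (Fin 3) → EuclideanSpace ℝ (Fin 3)} {φ : ℕ → ℕ} (hφ : StrictMono φ)
    {u : ℝ → EuclideanSpace ℝ (Fin 3) → EuclideanSpace ℝ (Fin 3)} {a : EuclideanSpace ℝ (Fin 3) → EuclideanSpace ℝ (Fin 3)}
    (hloc : ∀ k, IsLocalEnergySolutionOn Tℓ 1 (ak k) (v k) (p k))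
    (hakm : ∀ k, AEStronglyMeasurable (ak k) volume) (hakdiv : ∀ k, IsWeaklyDivFree (ak k))
    (hpm : ∀ k, StronglyMeasurable (uncurry (p k)))
    {G : ℕ → ℝ → EuclideanSpace ℝ (Fin 3) → EuclideanSpace ℝ (Fin 3) →L[ℝ] EuclideanSpace ℝ (Fin 3)}
    (hG : ∀ k, HasWeakSpatialGradientOn (slab (EuclideanSpace ℝ (Fin 3)) (Ioo 0 Tℓ) isOpen_Ioo) (v k) (G k))
    {Cen Cgr Cdat : ℝ≥0∞} (hCent : Cen ≠ ⊤) (hCgrt : Cgr ≠ ⊤) (hCdatt : Cdat ≠ ⊤)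
    (henk : ∀ k, ∀ᵐ t ∂(volume.restrict (Ioo (0 : ℝ) Tℓ)), ∀ x₀ : EuclideanSpace ℝ (Fin 3),
      ∫⁻ x in ball x₀ 1, ‖v k t x‖ₑ ^ 2 ≤ Cen)
    (hgrk : ∀ k (x₀ : EuclideanSpace ℝ (Fin 3)),
      ∫⁻ z in Ioo 0 Tℓ ×ˢ ball x₀ 1, ENNReal.ofReal (frobeniusNormSq (G k z.1 z.2)) ≤ Cgr)
    (hdat : ∀ k (x₀ : EuclideanSpace ℝ (Fin 3)), ∫⁻ x in ball x₀ 1, ‖ak k x‖ₑ ^ 2 ≤ Cdat)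
    (hakloc : ∀ k (ρ : ℝ), MemLp (ak k) 2 (volume.restrict (ball (0 : EuclideanSpace ℝ (Fin 3)) ρ)))
    (ham : AEStronglyMeasurable a volume)
    (haloc : ∀ ρ : ℝ, MemLp a 2 (volume.restrict (ball (0 : EuclideanSpace ℝ (Fin 3)) ρ)))
    (hconv : ∀ ρ : ℝ, 0 < ρ → Tendsto (fun k => ∫⁻ x in ball (0 : EuclideanSpace ℝ (Fin 3)) ρ,
      ‖ak k x - a x‖ₑ ^ (2 : ℕ)) atTop (𝓝 0))
    (hmeas : ∀ t ∈ Icc 0 T, AEStronglyMeasurable (u t) volume) {C : ℝ≥0}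
    (huC : ∀ t ∈ Icc 0 T, ∀ x₀ : EuclideanSpace ℝ (Fin 3), ∫⁻ x in ball x₀ 1, ‖u t x‖ₑ ^ 2 ≤ C)
    (hwc : ∀ ψ : EuclideanSpace ℝ (Fin 3) → EuclideanSpace ℝ (Fin 3),
      FunctionSpaces.IsTestFunctionOn (⊤ : Opens (EuclideanSpace ℝ (Fin 3))) ψ →
        ContinuousOn (fun t => ∫ x, ⟪u t x, ψ x⟫) (Icc 0 T))
    (hpt : ∀ t ∈ Icc 0 T, ∀ ψ : EuclideanSpace ℝ (Fin 3) → EuclideanSpace ℝ (Fin 3),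
      FunctionSpaces.IsTestFunctionOn (⊤ : Opens (EuclideanSpace ℝ (Fin 3))) ψ →
        Tendsto (fun k => ∫ x, ⟪v (φ k) t x, ψ x⟫) atTop (𝓝 (∫ x, ⟪u t x, ψ x⟫)))
    (hu0 : u 0 =ᵐ[volume] a) (d : EuclideanSpace ℝ (Fin 3)) :
    Tendsto (fun t => ∫⁻ x in ball d 1, ‖u t x - a x‖ₑ ^ 2) (𝓝[>] 0) (𝓝 0) := by
  have hTℓ0 : 0 < Tℓ := hT.trans_le hTℓ
  have h0 : (0 : ℝ) ∈ Icc 0 T := ⟨le_rfl, hT.le⟩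
  ------------------------------------------------------------------
  -- ## the cut-offs `θ`, `ψ = θ²`
  ------------------------------------------------------------------
  obtain ⟨hθtest, hθ0, hθ1, hθone, -, hθts⟩ := cutoff_shift_props d
  set θ : EuclideanSpace ℝ (Fin 3) → ℝ := fun x => cutoff (E := EuclideanSpace ℝ (Fin 3)) 1 (x - d) with hθ
  set r : ℝ := ‖d‖ + 3 with hr
  have hr0 : 0 < r := by rw [hr]; positivity
  set ψ : EuclideanSpace ℝ (Fin 3) → ℝ := fun x => θ x ^ 2 with hψ
  have hψcd : ContDiff ℝ (⊤ : ℕ∞) ψ := hθtest.contDiff.pow 2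
  have hψc : HasCompactSupport ψ := hθtest.hasCompactSupport.comp_left (g := fun t : ℝ => t ^ 2) (by simp)
  have hψts : tsupport ψ ⊆ tsupport θ :=
    tsupport_comp_subset (g := fun t : ℝ => t ^ 2) (by norm_num) θ
  have hψs : tsupport ψ ⊆ ball 0 r := hψts.trans hθts
  have hψ0 : ∀ x, 0 ≤ ψ x := fun x => sq_nonneg _
  have hψ1 : ∀ x, ψ x ≤ 1 := fun x => by
    simp only [hψ]; nlinarith [hθ0 x, hθ1 x]
  -- `Δψ`, `∇ψ` are bounded and vanish off `tsupport ψ ⊆ B(d, 3)`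
  obtain ⟨CL, hCL⟩ := (continuous_laplacian (hψcd.of_le (by norm_cast))).bounded_above_of_compact_support
    (hasCompactSupport_laplacian hψc)
  obtain ⟨CG, hCG⟩ := (hψcd.continuous_fderiv (by simp)).bounded_above_of_compact_support (hψc.fderiv (𝕜 := ℝ))
  have hCL0 : 0 ≤ CL := (norm_nonneg _).trans (hCL 0)
  have hCG0 : 0 ≤ CG := (norm_nonneg _).trans (hCG 0)
  have hgradψ : ∀ x, ‖gradient ψ x‖ ≤ CG := fun x => by
    rw [gradient, LinearIsometryEquiv.norm_map]; exact hCG x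
  have hθcb : tsupport θ ⊆ closedBall d 2 := by
    refine closure_minimal (fun x hx => ?_) isClosed_closedBall
    rw [mem_closedBall, dist_eq_norm]
    by_contra h
    exact hx (cutoff_eq_zero one_pos (by linarith [not_le.1 h]))
  have hS : ∀ x, x ∉ ball d 3 → (Δ ψ) x = 0 ∧ gradient ψ x = 0 := by
    intro x hx
    have hxt : x ∉ tsupport ψ := fun h => hx (by
      have h2 := hθcb (hψts h)
      rw [mem_closedBall] at h2
      rw [mem_ball]; linarith)
    exact ⟨laplacian_eq_zero_of_notMem_tsupport hxt, by
      rw [gradient, image_eq_zero_of_notMem_tsupport fun h => hxt (tsupport_fderiv_subset ℝ h), map_zero]⟩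
  have hball3 : ball d 3 ⊆ ball (0 : EuclideanSpace ℝ (Fin 3)) r := by
    intro x hx
    rw [mem_ball, dist_eq_norm] at hx
    rw [mem_ball_zero_iff]
    calc ‖x‖ = ‖(x - d) + d‖ := by rw [sub_add_cancel]
      _ ≤ ‖x - d‖ + ‖d‖ := norm_add_le _ _
      _ < r := by rw [hr]; linarith
  ------------------------------------------------------------------
  -- ## uniform constants: unit-ball cover of `B(d,3)`, Kang–Miura–Tsai, the cubic estimate
  ------------------------------------------------------------------
  obtain ⟨F₃, hF₃⟩ := exists_finset_ball_subset_biUnion_ball_one (3 : ℝ)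
  set A₀ : ℝ≥0 := (max (max Cen Cgr) Cdat).toNNReal with hA₀
  have hA₀E : (A₀ : ℝ≥0∞) = max (max Cen Cgr) Cdat := ENNReal.coe_toNNReal (by simp [hCent, hCgrt, hCdatt])
  have hCenA : Cen ≤ A₀ := by rw [hA₀E]; exact (le_max_left _ _).trans (le_max_left _ _)
  have hCgrA : Cgr ≤ A₀ := by rw [hA₀E]; exact (le_max_right _ _).trans (le_max_left _ _)
  have hCdatA : Cdat ≤ A₀ := by rw [hA₀E]; exact le_max_right _ _
  obtain ⟨Kp, hKp⟩ := kangMiuraTsai_local_pressure_bound_holds Tℓ 3 A₀ hTℓ0 (by norm_num)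
  obtain ⟨Kc, hKc⟩ := exists_lintegral_cube_box_le_explicit (1 : ℝ)
  -- the Leray structures on `(0, Tℓ)` and the hypotheses of Kang–Miura–Tsai
  have hLer : ∀ k, IsLocalLeraySolutionOn Tℓ 1 (ak k) (v k) (p k) := fun k => (hloc k).isLocalLeraySolutionOn
  have hgauge : ∀ k, ∃ c : ℝ → ℝ, Measurable c ∧ (∫⁻ t in Ioo 0 Tℓ, ‖c t‖ₑ ^ (3 / 2 : ℝ) < ⊤) ∧
      ∫⁻ z in Ioo 0 Tℓ ×ˢ ball d 3, ‖p k z.1 z.2 - c z.1‖ₑ ^ (3 / 2 : ℝ) ≤ Kp := by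
    intro k
    obtain ⟨c, hc32, hcK⟩ := hKp (ak k) (v k) (p k) (hLer k) (fun x₀ => (hdat k x₀).trans hCdatA) (hakdiv k)
      ((henk k).mono fun t ht x₀ => (ht x₀).trans hCenA) ⟨G k, hG k, fun x₀ => (hgrk k x₀).trans hCgrA⟩ d
    -- a measurable representative of the gauge
    set c' : ℝ → ℝ := hc32.1.mk c with hc'
    have hcc' : c =ᵐ[volume.restrict (Ioo (0 : ℝ) Tℓ)] c' := hc32.1.ae_eq_mk
    refine ⟨c', hc32.1.measurable_mk, ?_, ?_⟩
    · have h := hc32.2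
      rw [eLpNorm_lt_top_iff_lintegral_rpow_enorm_lt_top (by norm_num) (by simp [ENNReal.div_eq_top]), ENNReal.toReal_div,
        ENNReal.toReal_ofNat, ENNReal.toReal_ofNat] at h
      have e : ∫⁻ t in Ioo 0 Tℓ, ‖c' t‖ₑ ^ (3 / 2 : ℝ) = ∫⁻ t in Ioo 0 Tℓ, ‖c t‖ₑ ^ (3 / 2 : ℝ) :=
        lintegral_congr_ae (hcc'.mono fun t ht => by show ‖c' t‖ₑ ^ (3 / 2 : ℝ) = ‖c t‖ₑ ^ (3 / 2 : ℝ); rw [ht])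
      rw [e]; exact h
    · have e : ∫⁻ z in Ioo 0 Tℓ ×ˢ ball d 3, ‖p k z.1 z.2 - c' z.1‖ₑ ^ (3 / 2 : ℝ) =
          ∫⁻ z in Ioo 0 Tℓ ×ˢ ball d 3, ‖p k z.1 z.2 - c z.1‖ₑ ^ (3 / 2 : ℝ) := by
        refine lintegral_congr_ae ?_
        filter_upwards [ae_restrict_prod_of_ae_restrict hcc' (ball d 3)] with z hz
        show ‖p k z.1 z.2 - c' z.1‖ₑ ^ (3 / 2 : ℝ) = ‖p k z.1 z.2 - c z.1‖ₑ ^ (3 / 2 : ℝ)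
        rw [hz]
      rw [e]; exact hcK
  choose c hcm hc32 hcK using hgauge
  have hLer' : ∀ k, IsLocalLeraySolutionOn Tℓ 1 (ak k) (v k) (fun t x => p k t x - c k t) := fun k =>
    (hloc k).isLocalLeraySolutionOn_sub_gauge (hcm k) (hc32 k)
  ------------------------------------------------------------------
  -- ## the flux bound `ρ(σ)`, uniform in `k`, for `0 < σ ≤ 1`
  ------------------------------------------------------------------
  set N₃ : ℝ≥0∞ := (F₃.card : ℝ≥0∞) with hN₃
  set E₁ : ℝ≥0∞ := N₃ * (Kc * Cen ^ (1 / 2 : ℝ) * (Cen ^ (1 / 4 : ℝ) * (Cen + Cgr) ^ (3 / 4 : ℝ))) with hE₁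
  have hE₁t : E₁ ≠ ⊤ := by
    refine ENNReal.mul_ne_top (ENNReal.natCast_ne_top _) (ENNReal.mul_ne_top (ENNReal.mul_ne_top ENNReal.coe_ne_top
      (ENNReal.rpow_ne_top_of_nonneg (by norm_num) hCent)) (ENNReal.mul_ne_top (ENNReal.rpow_ne_top_of_nonneg (by norm_num) hCent)
      (ENNReal.rpow_ne_top_of_nonneg (by norm_num) (ENNReal.add_ne_top.2 ⟨hCent, hCgrt⟩))))
  set c₁ : ℝ≥0∞ := ENNReal.ofReal CL * (N₃ * Cen) with hc₁
  set c₂ : ℝ≥0∞ := ENNReal.ofReal CG * E₁ with hc₂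
  set c₃ : ℝ≥0∞ := 2 * ENNReal.ofReal CG * ((Kp : ℝ≥0∞) ^ (2 / 3 : ℝ) * E₁ ^ (1 / 3 : ℝ)) with hc₃
  have hc₁t : c₁ ≠ ⊤ := ENNReal.mul_ne_top ENNReal.ofReal_ne_top (ENNReal.mul_ne_top (ENNReal.natCast_ne_top _) hCent)
  have hc₂t : c₂ ≠ ⊤ := ENNReal.mul_ne_top ENNReal.ofReal_ne_top hE₁t
  have hc₃t : c₃ ≠ ⊤ := ENNReal.mul_ne_top (ENNReal.mul_ne_top ENNReal.ofNat_ne_top ENNReal.ofReal_ne_top)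
    (ENNReal.mul_ne_top (ENNReal.rpow_ne_top_of_nonneg (by norm_num) ENNReal.coe_ne_top) (ENNReal.rpow_ne_top_of_nonneg (by norm_num) hE₁t))
  set ρ : ℝ → ℝ≥0∞ := fun σ => c₁ * ENNReal.ofReal σ + c₂ * ENNReal.ofReal σ ^ (1 / 4 : ℝ) + c₃ * ENNReal.ofReal σ ^ (1 / 12 : ℝ) with hρdef
  have hρt : ∀ σ, ρ σ ≠ ⊤ := fun σ => by
    refine ENNReal.add_ne_top.2 ⟨ENNReal.add_ne_top.2 ⟨ENNReal.mul_ne_top hc₁t ENNReal.ofReal_ne_top,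
      ENNReal.mul_ne_top hc₂t (ENNReal.rpow_ne_top_of_nonneg (by norm_num) ENNReal.ofReal_ne_top)⟩,
      ENNReal.mul_ne_top hc₃t (ENNReal.rpow_ne_top_of_nonneg (by norm_num) ENNReal.ofReal_ne_top)⟩
  have hρ0 : Tendsto ρ (𝓝[>] 0) (𝓝 0) := tendsto_flux_modulus hc₁t hc₂t hc₃t
  -- ### the cubic bound on `(0,σ) × B(d,3)`
  have hcube : ∀ k {σ : ℝ}, 0 < σ → σ ≤ 1 →
      ∫⁻ z in Ioo 0 σ ×ˢ ball d 3, ‖v k z.1 z.2‖ₑ ^ (3 : ℕ) ≤ E₁ * ENNReal.ofReal σ ^ (1 / 4 : ℝ) := by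
    intro k σ hσ hσ1
    have hσT : σ ≤ Tℓ := hσ1.trans (hT1.trans hTℓ)
    have hGσ : HasWeakSpatialGradientOn (slab (EuclideanSpace ℝ (Fin 3)) (Ioo 0 σ) isOpen_Ioo) (v k) (G k) :=
      (hG k).mono (slab_mono (Ioo_subset_Ioo_right hσT))
    have henσ : ∀ x₀ : EuclideanSpace ℝ (Fin 3), ∀ᵐ t ∂(volume.restrict (Ioo (0 : ℝ) σ)),
        ∫⁻ x in ball x₀ 1, ‖v k t x‖ₑ ^ 2 ≤ Cen := fun x₀ =>
      (ae_restrict_of_ae_restrict_of_subset (Ioo_subset_Ioo_right hσT) (henk k)).mono fun t ht => ht x₀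
    have hone : ∀ c' : EuclideanSpace ℝ (Fin 3), ∫⁻ z in Ioo 0 σ ×ˢ ball (d + c') 1, ‖v k z.1 z.2‖ₑ ^ (3 : ℕ) ≤
        Kc * Cen ^ (1 / 2 : ℝ) * ((Cen * volume (Ioo (0 : ℝ) σ)) ^ (1 / 4 : ℝ) * (Cen * volume (Ioo (0 : ℝ) σ) + Cgr) ^ (3 / 4 : ℝ)) := by
      intro c'
      exact hKc σ (v k) (G k) (d + c') Cen Cgr hCent hGσ (henσ (d + c'))
        ((lintegral_mono_set (Set.prod_mono (Ioo_subset_Ioo_right hσT) Subset.rfl)).trans (hgrk k (d + c')))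
    have hvol : volume (Ioo (0 : ℝ) σ) = ENNReal.ofReal σ := by rw [Real.volume_Ioo, sub_zero]
    have hmono : Kc * Cen ^ (1 / 2 : ℝ) * ((Cen * volume (Ioo (0 : ℝ) σ)) ^ (1 / 4 : ℝ) * (Cen * volume (Ioo (0 : ℝ) σ) + Cgr) ^ (3 / 4 : ℝ)) ≤
        Kc * Cen ^ (1 / 2 : ℝ) * (Cen ^ (1 / 4 : ℝ) * (Cen + Cgr) ^ (3 / 4 : ℝ)) * ENNReal.ofReal σ ^ (1 / 4 : ℝ) := by
      rw [hvol]
      have hσE : ENNReal.ofReal σ ≤ 1 := ENNReal.ofReal_le_one.2 hσ1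
      have h1 : (Cen * ENNReal.ofReal σ + Cgr) ^ (3 / 4 : ℝ) ≤ (Cen + Cgr) ^ (3 / 4 : ℝ) := by
        refine ENNReal.rpow_le_rpow (add_le_add ?_ le_rfl) (by norm_num)
        calc Cen * ENNReal.ofReal σ ≤ Cen * 1 := mul_le_mul' le_rfl hσE
          _ = Cen := mul_one _
      have h2 : (Cen * ENNReal.ofReal σ) ^ (1 / 4 : ℝ) = Cen ^ (1 / 4 : ℝ) * ENNReal.ofReal σ ^ (1 / 4 : ℝ) :=
        ENNReal.mul_rpow_of_nonneg _ _ (by norm_num)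
      rw [h2]
      calc Kc * Cen ^ (1 / 2 : ℝ) * (Cen ^ (1 / 4 : ℝ) * ENNReal.ofReal σ ^ (1 / 4 : ℝ) * (Cen * ENNReal.ofReal σ + Cgr) ^ (3 / 4 : ℝ))
          ≤ Kc * Cen ^ (1 / 2 : ℝ) * (Cen ^ (1 / 4 : ℝ) * ENNReal.ofReal σ ^ (1 / 4 : ℝ) * (Cen + Cgr) ^ (3 / 4 : ℝ)) :=
            mul_le_mul' le_rfl (mul_le_mul' le_rfl h1)
        _ = _ := by ring
    calc ∫⁻ z in Ioo 0 σ ×ˢ ball d 3, ‖v k z.1 z.2‖ₑ ^ (3 : ℕ)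
        ≤ ∫⁻ z in ⋃ c' ∈ F₃, Ioo 0 σ ×ˢ ball (d + c') 1, ‖v k z.1 z.2‖ₑ ^ (3 : ℕ) := by
          refine lintegral_mono_set fun z hz => ?_
          rw [Set.mem_prod] at hz
          have h := hF₃ d hz.2
          simp only [mem_iUnion] at h ⊢
          obtain ⟨c', hc', hzc⟩ := h
          exact ⟨c', hc', Set.mem_prod.2 ⟨hz.1, hzc⟩⟩
      _ ≤ F₃.card * (Kc * Cen ^ (1 / 2 : ℝ) * ((Cen * volume (Ioo (0 : ℝ) σ)) ^ (1 / 4 : ℝ) * (Cen * volume (Ioo (0 : ℝ) σ) + Cgr) ^ (3 / 4 : ℝ))) :=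
          lintegral_biUnion_finset_le_card_mul F₃ _ _ fun c' _ => hone c'
      _ ≤ F₃.card * (Kc * Cen ^ (1 / 2 : ℝ) * (Cen ^ (1 / 4 : ℝ) * (Cen + Cgr) ^ (3 / 4 : ℝ)) * ENNReal.ofReal σ ^ (1 / 4 : ℝ)) := by gcongr
      _ = E₁ * ENNReal.ofReal σ ^ (1 / 4 : ℝ) := by rw [hE₁, hN₃]; ring
  -- ### the quadratic bound on `(0,σ) × B(d,3)`
  have hsqb : ∀ k {σ : ℝ}, 0 < σ → σ ≤ 1 →
      ∫⁻ z in Ioo 0 σ ×ˢ ball d 3, ‖v k z.1 z.2‖ₑ ^ 2 ≤ N₃ * Cen * ENNReal.ofReal σ := by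
    intro k σ hσ hσ1
    have hσT : σ ≤ Tℓ := hσ1.trans (hT1.trans hTℓ)
    have hslice : ∀ᵐ t ∂(volume.restrict (Ioo (0 : ℝ) σ)), ∫⁻ x in ball d 3, ‖v k t x‖ₑ ^ 2 ≤ N₃ * Cen := by
      filter_upwards [ae_restrict_of_ae_restrict_of_subset (Ioo_subset_Ioo_right hσT) (henk k)] with t ht
      exact (lintegral_mono_set (hF₃ d)).trans (lintegral_biUnion_finset_le_card_mul F₃ _ _ fun c' _ => ht (d + c'))
    have hvm' : AEMeasurable (fun z : ℝ × EuclideanSpace ℝ (Fin 3) => ‖v k z.1 z.2‖ₑ ^ 2)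
        (volume.restrict (Ioo (0 : ℝ) σ ×ˢ ball d 3)) := by
      have h := ((hLer k).aestronglyMeasurable.mono_set (show Ioo (0 : ℝ) σ ×ˢ ball d 3 ⊆ Ioo 0 Tℓ ×ˢ univ from
        Set.prod_mono (Ioo_subset_Ioo_right hσT) (subset_univ _))).aemeasurable
      exact h.enorm.pow_const _
    have hvm : AEMeasurable (fun z : ℝ × EuclideanSpace ℝ (Fin 3) => ‖v k z.1 z.2‖ₑ ^ 2)
        ((volume.restrict (Ioo (0 : ℝ) σ)).prod (volume.restrict (ball d 3))) := by
      rw [Measure.prod_restrict, ← Measure.volume_eq_prod]; exact hvm'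
    calc ∫⁻ z in Ioo 0 σ ×ˢ ball d 3, ‖v k z.1 z.2‖ₑ ^ 2
        = ∫⁻ z, ‖v k z.1 z.2‖ₑ ^ 2 ∂((volume.restrict (Ioo (0 : ℝ) σ)).prod (volume.restrict (ball d 3))) := by
          rw [Measure.prod_restrict, ← Measure.volume_eq_prod]
      _ = ∫⁻ t in Ioo 0 σ, ∫⁻ x in ball d 3, ‖v k t x‖ₑ ^ 2 := lintegral_prod _ hvm
      _ ≤ ∫⁻ _ in Ioo (0 : ℝ) σ, N₃ * Cen := lintegral_mono_ae hslice
      _ = N₃ * Cen * ENNReal.ofReal σ := by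
          rw [setLIntegral_const, Real.volume_Ioo, sub_zero]
  -- ### the flux bound
  have hflux : ∀ k {σ : ℝ}, 0 < σ → σ ≤ 1 →
      ∫⁻ z in Ioo 0 σ ×ˢ ball (0 : EuclideanSpace ℝ (Fin 3)) r,
        ‖‖v k z.1 z.2‖ ^ 2 * Δ ψ z.2 + (‖v k z.1 z.2‖ ^ 2 + 2 * (p k z.1 z.2 - c k z.1)) * ⟪v k z.1 z.2, gradient ψ z.2⟫‖ₑ ≤ ρ σ := by
    intro k σ hσ hσ1
    have hσT : σ ≤ Tℓ := hσ1.trans (hT1.trans hTℓ)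
    set Sσ : Set (ℝ × EuclideanSpace ℝ (Fin 3)) := Ioo 0 σ ×ˢ ball d 3 with hSσ
    have hSm : MeasurableSet Sσ := measurableSet_Ioo.prod measurableSet_ball
    set μS : Measure (ℝ × EuclideanSpace ℝ (Fin 3)) := volume.restrict Sσ with hμS
    -- the integrand vanishes off `ℝ × B(d,3)` and is bounded there
    set g : ℝ × EuclideanSpace ℝ (Fin 3) → ℝ≥0∞ := fun z =>
      ENNReal.ofReal CL * ‖v k z.1 z.2‖ₑ ^ 2 + ENNReal.ofReal CG * ‖v k z.1 z.2‖ₑ ^ (3 : ℕ) +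
        2 * ENNReal.ofReal CG * (‖p k z.1 z.2 - c k z.1‖ₑ * ‖v k z.1 z.2‖ₑ) with hg
    have hpt : ∀ z : ℝ × EuclideanSpace ℝ (Fin 3),
        ‖‖v k z.1 z.2‖ ^ 2 * Δ ψ z.2 + (‖v k z.1 z.2‖ ^ 2 + 2 * (p k z.1 z.2 - c k z.1)) * ⟪v k z.1 z.2, gradient ψ z.2⟫‖ₑ ≤
          ((univ : Set ℝ) ×ˢ ball d 3).indicator g z := by
      intro z
      by_cases hz : z.2 ∈ ball d 3
      · rw [indicator_of_mem (Set.mem_prod.2 ⟨mem_univ _, hz⟩)]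
        simp only [hg]
        rw [← ofReal_norm]
        have hv0 := norm_nonneg (v k z.1 z.2)
        have hin : |⟪v k z.1 z.2, gradient ψ z.2⟫| ≤ ‖v k z.1 z.2‖ * CG :=
          (abs_real_inner_le_norm _ _).trans (mul_le_mul_of_nonneg_left (hgradψ z.2) hv0)
        have hA : ‖‖v k z.1 z.2‖ ^ 2 * Δ ψ z.2‖ ≤ CL * ‖v k z.1 z.2‖ ^ 2 := by
          rw [norm_mul, Real.norm_eq_abs, abs_of_nonneg (sq_nonneg _)]
          calc ‖v k z.1 z.2‖ ^ 2 * ‖Δ ψ z.2‖ ≤ ‖v k z.1 z.2‖ ^ 2 * CL := mul_le_mul_of_nonneg_left (hCL z.2) (sq_nonneg _)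
            _ = CL * ‖v k z.1 z.2‖ ^ 2 := mul_comm _ _
        have hB : ‖(‖v k z.1 z.2‖ ^ 2 + 2 * (p k z.1 z.2 - c k z.1)) * ⟪v k z.1 z.2, gradient ψ z.2⟫‖ ≤
            CG * ‖v k z.1 z.2‖ ^ 3 + 2 * CG * (|p k z.1 z.2 - c k z.1| * ‖v k z.1 z.2‖) := by
          rw [norm_mul, Real.norm_eq_abs, Real.norm_eq_abs]
          calc |‖v k z.1 z.2‖ ^ 2 + 2 * (p k z.1 z.2 - c k z.1)| * |⟪v k z.1 z.2, gradient ψ z.2⟫|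
              ≤ (‖v k z.1 z.2‖ ^ 2 + 2 * |p k z.1 z.2 - c k z.1|) * (‖v k z.1 z.2‖ * CG) := by
                refine mul_le_mul ((abs_add_le _ _).trans (add_le_add (le_of_eq (abs_of_nonneg (sq_nonneg _))) ?_)) hin
                  (abs_nonneg _) (by positivity)
                rw [abs_mul, abs_two]
            _ = CG * ‖v k z.1 z.2‖ ^ 3 + 2 * CG * (|p k z.1 z.2 - c k z.1| * ‖v k z.1 z.2‖) := by ring
        have h1 : ‖‖v k z.1 z.2‖ ^ 2 * Δ ψ z.2 + (‖v k z.1 z.2‖ ^ 2 + 2 * (p k z.1 z.2 - c k z.1)) * ⟪v k z.1 z.2, gradient ψ z.2⟫‖ ≤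
            CL * ‖v k z.1 z.2‖ ^ 2 + CG * ‖v k z.1 z.2‖ ^ 3 + 2 * CG * (|p k z.1 z.2 - c k z.1| * ‖v k z.1 z.2‖) := by
          have h := (norm_add_le _ _).trans (add_le_add hA hB)
          linarith
        refine (ENNReal.ofReal_le_ofReal h1).trans (le_of_eq ?_)
        rw [ENNReal.ofReal_add (by positivity) (by positivity), ENNReal.ofReal_add (by positivity) (by positivity),
          ENNReal.ofReal_mul hCL0, ENNReal.ofReal_mul hCG0, ENNReal.ofReal_mul (by positivity), ENNReal.ofReal_mul zero_le_two,
          ENNReal.ofReal_mul (abs_nonneg _), ENNReal.ofReal_ofNat, ← ofReal_norm, ← ofReal_norm (p k z.1 z.2 - c k z.1),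
          Real.norm_eq_abs, ENNReal.ofReal_pow hv0, ENNReal.ofReal_pow hv0]
      · rw [indicator_of_notMem (fun h => hz (Set.mem_prod.1 h).2)]
        obtain ⟨hL, hGr⟩ := hS z.2 hz
        rw [hL, hGr, inner_zero_right, mul_zero, mul_zero, add_zero, enorm_zero]
    -- integrate
    have hmeasv : AEStronglyMeasurable (uncurry (v k)) μS :=
      (hLer k).aestronglyMeasurable.mono_set (Set.prod_mono (Ioo_subset_Ioo_right hσT) (subset_univ _))
    have hvme : AEMeasurable (fun z : ℝ × EuclideanSpace ℝ (Fin 3) => ‖v k z.1 z.2‖ₑ) μS := hmeasv.aemeasurable.enorm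
    have hpme : AEMeasurable (fun z : ℝ × EuclideanSpace ℝ (Fin 3) => ‖p k z.1 z.2 - c k z.1‖ₑ) μS :=
      (((hpm k).measurable.sub ((hcm k).comp measurable_fst)).aemeasurable).enorm
    have hI1 : ∫⁻ z, ‖v k z.1 z.2‖ₑ ^ 2 ∂μS ≤ N₃ * Cen * ENNReal.ofReal σ := hsqb k hσ hσ1
    have hI2 : ∫⁻ z, ‖v k z.1 z.2‖ₑ ^ (3 : ℕ) ∂μS ≤ E₁ * ENNReal.ofReal σ ^ (1 / 4 : ℝ) := hcube k hσ hσ1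
    have hI3 : ∫⁻ z, ‖p k z.1 z.2 - c k z.1‖ₑ * ‖v k z.1 z.2‖ₑ ∂μS ≤
        (Kp : ℝ≥0∞) ^ (2 / 3 : ℝ) * (E₁ * ENNReal.ofReal σ ^ (1 / 4 : ℝ)) ^ (1 / 3 : ℝ) := by
      have hpq : Real.HolderConjugate (3 / 2) 3 := Real.holderConjugate_iff.2 ⟨by norm_num, by norm_num⟩
      have hH := ENNReal.lintegral_mul_le_Lp_mul_Lq μS hpq hpme hvme
      simp only [Pi.mul_apply] at hH
      rw [show (1 : ℝ) / (3 / 2) = 2 / 3 by norm_num] at hH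
      refine hH.trans (mul_le_mul' (ENNReal.rpow_le_rpow ?_ (by norm_num)) (ENNReal.rpow_le_rpow ?_ (by norm_num)))
      · -- the gauged pressure on `(0,σ) × B(d,3) ⊆ (0,Tℓ) × B(d,3)`
        exact (lintegral_mono_set (Set.prod_mono (Ioo_subset_Ioo_right hσT) Subset.rfl)).trans (hcK k)
      · have e : ∀ z : ℝ × EuclideanSpace ℝ (Fin 3), ‖v k z.1 z.2‖ₑ ^ (3 : ℝ) = ‖v k z.1 z.2‖ₑ ^ (3 : ℕ) := fun z => by
          rw [← ENNReal.rpow_natCast]; norm_num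
        simp_rw [e]; exact hI2
    -- assemble
    have hgint : ∫⁻ z, g z ∂μS ≤ ρ σ := by
      have hm1 : AEMeasurable (fun z : ℝ × EuclideanSpace ℝ (Fin 3) => ENNReal.ofReal CL * ‖v k z.1 z.2‖ₑ ^ 2) μS :=
        (hvme.pow_const _).const_mul _
      have hm2 : AEMeasurable (fun z : ℝ × EuclideanSpace ℝ (Fin 3) => ENNReal.ofReal CG * ‖v k z.1 z.2‖ₑ ^ (3 : ℕ)) μS :=
        (hvme.pow_const _).const_mul _
      have hm12 : AEMeasurable (fun z : ℝ × EuclideanSpace ℝ (Fin 3) =>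
          ENNReal.ofReal CL * ‖v k z.1 z.2‖ₑ ^ 2 + ENNReal.ofReal CG * ‖v k z.1 z.2‖ₑ ^ (3 : ℕ)) μS := hm1.add hm2
      simp only [hg]
      rw [lintegral_add_left' hm12, lintegral_add_left' hm1, lintegral_const_mul' _ _ ENNReal.ofReal_ne_top,
        lintegral_const_mul' _ _ ENNReal.ofReal_ne_top,
        lintegral_const_mul' _ _ (ENNReal.mul_ne_top ENNReal.ofNat_ne_top ENNReal.ofReal_ne_top)]
      simp only [hρdef, hc₁, hc₂, hc₃]
      refine add_le_add (add_le_add ?_ ?_) ?_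
      · calc ENNReal.ofReal CL * ∫⁻ z, ‖v k z.1 z.2‖ₑ ^ 2 ∂μS ≤ ENNReal.ofReal CL * (N₃ * Cen * ENNReal.ofReal σ) :=
              mul_le_mul' le_rfl hI1
          _ = ENNReal.ofReal CL * (N₃ * Cen) * ENNReal.ofReal σ := by ring
      · calc ENNReal.ofReal CG * ∫⁻ z, ‖v k z.1 z.2‖ₑ ^ (3 : ℕ) ∂μS ≤ ENNReal.ofReal CG * (E₁ * ENNReal.ofReal σ ^ (1 / 4 : ℝ)) :=
              mul_le_mul' le_rfl hI2
          _ = ENNReal.ofReal CG * E₁ * ENNReal.ofReal σ ^ (1 / 4 : ℝ) := by ring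
      · calc 2 * ENNReal.ofReal CG * ∫⁻ z, ‖p k z.1 z.2 - c k z.1‖ₑ * ‖v k z.1 z.2‖ₑ ∂μS
            ≤ 2 * ENNReal.ofReal CG * ((Kp : ℝ≥0∞) ^ (2 / 3 : ℝ) * (E₁ * ENNReal.ofReal σ ^ (1 / 4 : ℝ)) ^ (1 / 3 : ℝ)) :=
              mul_le_mul' le_rfl hI3
          _ = 2 * ENNReal.ofReal CG * ((Kp : ℝ≥0∞) ^ (2 / 3 : ℝ) * E₁ ^ (1 / 3 : ℝ)) * ENNReal.ofReal σ ^ (1 / 12 : ℝ) := by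
              rw [ENNReal.mul_rpow_of_nonneg _ _ (by norm_num : (0 : ℝ) ≤ 1 / 3), ← ENNReal.rpow_mul]
              norm_num; ring
    calc ∫⁻ z in Ioo 0 σ ×ˢ ball (0 : EuclideanSpace ℝ (Fin 3)) r,
          ‖‖v k z.1 z.2‖ ^ 2 * Δ ψ z.2 + (‖v k z.1 z.2‖ ^ 2 + 2 * (p k z.1 z.2 - c k z.1)) * ⟪v k z.1 z.2, gradient ψ z.2⟫‖ₑ
        ≤ ∫⁻ z in Ioo 0 σ ×ˢ ball (0 : EuclideanSpace ℝ (Fin 3)) r, ((univ : Set ℝ) ×ˢ ball d 3).indicator g z := lintegral_mono hpt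
      _ = ∫⁻ z, g z ∂μS := by
          rw [lintegral_indicator (MeasurableSet.univ.prod measurableSet_ball), Measure.restrict_restrict
            (MeasurableSet.univ.prod measurableSet_ball), hμS, hSσ]
          congr 1
          rw [Set.prod_inter_prod, univ_inter, inter_eq_left.2 hball3]
      _ ≤ ρ σ := hgint
  ------------------------------------------------------------------
  -- ## Claim B: `∫ |v_k(t₀)|²ψ ≤ ∫ |a_k|²ψ + ρ(σ)` for every `t₀ ∈ (0,σ)`, `σ ≤ 1`
  ------------------------------------------------------------------
  have hakψ : ∀ k, Integrable (fun x => ‖ak k x‖ ^ 2 * ψ x) volume := by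
    intro k
    have h2 : Integrable (fun x => ‖ak k x‖ ^ 2) (volume.restrict (ball (0 : EuclideanSpace ℝ (Fin 3)) r)) :=
      (memLp_two_iff_integrable_sq_norm (hakloc k r).1).1 (hakloc k r)
    have h1 : Integrable (fun x => ‖ak k x‖ ^ 2 * ψ x) (volume.restrict (ball (0 : EuclideanSpace ℝ (Fin 3)) r)) :=
      h2.mul_bdd hψcd.continuous.aestronglyMeasurable (Eventually.of_forall fun x => by
        rw [Real.norm_eq_abs, abs_of_nonneg (hψ0 x)]; exact hψ1 x)
    refine (integrableOn_iff_integrable_of_support_subset (s := ball (0 : EuclideanSpace ℝ (Fin 3)) r) ?_).1 h1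
    intro x hx
    by_contra hxB
    have : ψ x = 0 := image_eq_zero_of_notMem_tsupport fun h => hxB (hψs h)
    exact hx (by simp [this])
  have hB : ∀ k {σ : ℝ}, 0 < σ → σ ≤ 1 → ∀ t₀ ∈ Ioo 0 σ,
      ∫ x, ‖v k t₀ x‖ ^ 2 * ψ x ≤ (∫ x, ‖ak k x‖ ^ 2 * ψ x) + (ρ σ).toReal := by
    intro k σ hσ hσ1 t₀ ht₀
    exact (hloc k).integral_sq_mul_le_of_flux_le (hLer' k) (hakm k) (hG k) hψcd hψc hψs hψ0 (hakψ k) hσ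
      (hσ1.trans (hT1.trans hTℓ)) (hρt σ) (hflux k hσ hσ1) t₀ ht₀
  ------------------------------------------------------------------
  -- ## Claim C: `∫ |θ u(t₀)|² ≤ ∫ |θ a|² + ρ(σ)` for every `t₀ ∈ (0,σ)`, `σ ≤ 1`, `σ ≤ T`
  ------------------------------------------------------------------
  -- the weighted energies as lower integrals
  set W : (EuclideanSpace ℝ (Fin 3) → EuclideanSpace ℝ (Fin 3)) → ℝ≥0∞ := fun f => ∫⁻ x, ‖θ x • f x‖ₑ ^ 2 with hW
  have hθc : Continuous θ := hθtest.contDiff.continuous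
  -- `θ f ∈ L²` for `f ∈ L²(B(0,r))`
  have hθL2 : ∀ {f : EuclideanSpace ℝ (Fin 3) → EuclideanSpace ℝ (Fin 3)}, AEStronglyMeasurable f volume →
      MemLp f 2 (volume.restrict (ball (0 : EuclideanSpace ℝ (Fin 3)) r)) → MemLp (fun x => θ x • f x) 2 volume := by
    intro f hfm hf
    have h1 : MemLp (fun x => θ x • f x) 2 (volume.restrict (ball (0 : EuclideanSpace ℝ (Fin 3)) r)) :=
      (hf.const_smul' (c := (1 : ℝ))).of_le_mul (c := 1) ((hθc.aestronglyMeasurable.smul hfm).restrict)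
        (Eventually.of_forall fun x => by
          have h1 : |θ x| ≤ 1 := by rw [abs_of_nonneg (hθ0 x)]; exact hθ1 x
          simp only [norm_smul, one_smul, Real.norm_eq_abs, one_mul]
          exact mul_le_of_le_one_left (norm_nonneg _) h1)
    have h2 := (memLp_indicator_iff_restrict (measurableSet_ball (x := (0 : EuclideanSpace ℝ (Fin 3))) (ε := r))).2 h1
    refine h2.ae_eq (Eventually.of_forall fun x => ?_)
    by_cases hx : x ∈ ball (0 : EuclideanSpace ℝ (Fin 3)) r
    · rw [indicator_of_mem hx]
    · rw [indicator_of_notMem hx]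
      have : θ x = 0 := image_eq_zero_of_notMem_tsupport fun h => hx (hθts h)
      simp [this]
  have hθvan : ∀ x, x ∉ ball (0 : EuclideanSpace ℝ (Fin 3)) r → θ x = 0 := fun x hx =>
    image_eq_zero_of_notMem_tsupport fun h => hx (hθts h)
  -- `W` in terms of the real weighted energy
  have hWreal : ∀ {f : EuclideanSpace ℝ (Fin 3) → EuclideanSpace ℝ (Fin 3)}, Integrable (fun x => ‖f x‖ ^ 2 * ψ x) volume →
      W f = ENNReal.ofReal (∫ x, ‖f x‖ ^ 2 * ψ x) := fun {f} hf => lintegral_enorm_smul_sq_eq_ofReal_integral hf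
  -- integrability of `‖f‖²ψ` for `f ∈ L²(B(0,r))`
  have hintψ : ∀ {f : EuclideanSpace ℝ (Fin 3) → EuclideanSpace ℝ (Fin 3)},
      MemLp f 2 (volume.restrict (ball (0 : EuclideanSpace ℝ (Fin 3)) r)) → Integrable (fun x => ‖f x‖ ^ 2 * ψ x) volume := by
    intro f hf
    have h2 : Integrable (fun x => ‖f x‖ ^ 2) (volume.restrict (ball (0 : EuclideanSpace ℝ (Fin 3)) r)) :=
      (memLp_two_iff_integrable_sq_norm hf.1).1 hf
    have h1 : Integrable (fun x => ‖f x‖ ^ 2 * ψ x) (volume.restrict (ball (0 : EuclideanSpace ℝ (Fin 3)) r)) :=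
      h2.mul_bdd hψcd.continuous.aestronglyMeasurable (Eventually.of_forall fun x => by
        rw [Real.norm_eq_abs, abs_of_nonneg (hψ0 x)]; exact hψ1 x)
    refine (integrableOn_iff_integrable_of_support_subset (s := ball (0 : EuclideanSpace ℝ (Fin 3)) r) ?_).1 h1
    intro x hx
    by_contra hxB
    have : ψ x = 0 := image_eq_zero_of_notMem_tsupport fun h => hxB (hψs h)
    exact hx (by simp [this])
  -- the slices of `u` are in `L²(B(0,r))`
  obtain ⟨Cr, hCr⟩ := exists_lintegral_ball_le_of_unitBall (fun t : Icc (0 : ℝ) T => u t) (fun t x₀ => huC t t.2 x₀) r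
  have hur : ∀ t ∈ Icc (0 : ℝ) T, MemLp (u t) 2 (volume.restrict (ball (0 : EuclideanSpace ℝ (Fin 3)) r)) := by
    intro t ht
    refine ⟨(hmeas t ht).restrict, ?_⟩
    rw [eLpNorm_two_eq_rpow_lintegral_sq]
    exact ENNReal.rpow_lt_top_of_nonneg (by norm_num) ((hCr ⟨t, ht⟩ 0).trans_lt ENNReal.coe_lt_top).ne
  -- `W(a_k) → W(a)`
  have hWa : Tendsto (fun k => W (ak k)) atTop (𝓝 (W a)) := by
    -- `‖θ(a_k − a)‖₂ → 0`, hence `‖θ a_k‖₂ → ‖θ a‖₂`, hence the squares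
    have hNk : ∀ k, MemLp (fun x => θ x • ak k x) 2 volume := fun k => hθL2 (hakm k) (hakloc k r)
    have hNa : MemLp (fun x => θ x • a x) 2 volume := hθL2 ham (haloc r)
    have hdiff0 : Tendsto (fun k => eLpNorm (fun x => θ x • ak k x - θ x • a x) 2 volume) atTop (𝓝 0) := by
      have hb : ∀ k, eLpNorm (fun x => θ x • ak k x - θ x • a x) 2 volume ≤
          (∫⁻ x in ball (0 : EuclideanSpace ℝ (Fin 3)) r, ‖ak k x - a x‖ₑ ^ (2 : ℕ)) ^ (1 / 2 : ℝ) := by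
        intro k
        rw [eLpNorm_two_eq_rpow_lintegral_sq]
        refine ENNReal.rpow_le_rpow ?_ (by norm_num)
        rw [← lintegral_indicator measurableSet_ball]
        refine lintegral_mono fun x => ?_
        by_cases hx : x ∈ ball (0 : EuclideanSpace ℝ (Fin 3)) r
        · rw [indicator_of_mem hx, ← smul_sub, enorm_smul]
          refine pow_le_pow_left' ?_ 2
          calc ‖θ x‖ₑ * ‖ak k x - a x‖ₑ ≤ 1 * ‖ak k x - a x‖ₑ := by
                refine mul_le_mul' ?_ le_rfl
                rw [Real.enorm_eq_ofReal (hθ0 x)]; exact ENNReal.ofReal_le_one.2 (hθ1 x)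
            _ = ‖ak k x - a x‖ₑ := one_mul _
        · rw [indicator_of_notMem hx, hθvan x hx, zero_smul, zero_smul, sub_zero, enorm_zero, zero_pow two_ne_zero]
      have h0 : Tendsto (fun k => (∫⁻ x in ball (0 : EuclideanSpace ℝ (Fin 3)) r, ‖ak k x - a x‖ₑ ^ (2 : ℕ)) ^ (1 / 2 : ℝ)) atTop (𝓝 0) := by
        have h := ((ENNReal.continuous_rpow_const (y := (1 / 2 : ℝ))).tendsto 0).comp (hconv r hr0)
        rwa [ENNReal.zero_rpow_of_pos (by norm_num)] at h
      exact tendsto_of_tendsto_of_tendsto_of_le_of_le tendsto_const_nhds h0 (fun _ => zero_le) hb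
    set nA : ℝ≥0∞ := eLpNorm (fun x => θ x • a x) 2 volume with hnA
    have hnAt : nA ≠ ⊤ := hNa.eLpNorm_ne_top
    set dk : ℕ → ℝ≥0∞ := fun k => eLpNorm (fun x => θ x • ak k x - θ x • a x) 2 volume with hdk
    have hnorm : Tendsto (fun k => eLpNorm (fun x => θ x • ak k x) 2 volume) atTop (𝓝 nA) := by
      have hup : ∀ k, eLpNorm (fun x => θ x • ak k x) 2 volume ≤ nA + dk k := fun k => by
        have e : (fun x => θ x • ak k x) = (fun x => θ x • a x) + fun x => θ x • ak k x - θ x • a x := by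
          funext x; simp only [Pi.add_apply]; abel
        rw [e]
        exact eLpNorm_add_le hNa.1 ((hNk k).1.sub hNa.1) one_le_two
      have hlow : ∀ k, nA - dk k ≤ eLpNorm (fun x => θ x • ak k x) 2 volume := fun k => by
        refine tsub_le_iff_right.2 ?_
        have e : (fun x => θ x • a x) = (fun x => θ x • ak k x) + fun x => θ x • a x - θ x • ak k x := by
          funext x; simp only [Pi.add_apply]; abel
        calc nA = eLpNorm ((fun x => θ x • ak k x) + fun x => θ x • a x - θ x • ak k x) 2 volume := by rw [hnA, ← e]
          _ ≤ eLpNorm (fun x => θ x • ak k x) 2 volume + eLpNorm (fun x => θ x • a x - θ x • ak k x) 2 volume :=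
              eLpNorm_add_le (hNk k).1 (hNa.1.sub (hNk k).1) one_le_two
          _ = eLpNorm (fun x => θ x • ak k x) 2 volume + dk k := by
              rw [hdk]; congr 1
              exact eLpNorm_sub_comm _ _ _ _
      have h1 : Tendsto (fun k => nA + dk k) atTop (𝓝 nA) := by
        have h := hdiff0.const_add nA
        rwa [add_zero] at h
      have h2 : Tendsto (fun k => nA - dk k) atTop (𝓝 nA) := by
        have h := ENNReal.Tendsto.sub (tendsto_const_nhds (x := nA)) hdiff0 (Or.inl hnAt)
        rwa [tsub_zero] at h
      exact tendsto_of_tendsto_of_tendsto_of_le_of_le h2 h1 hlow hup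
    have e : ∀ f : EuclideanSpace ℝ (Fin 3) → EuclideanSpace ℝ (Fin 3), W f = eLpNorm (fun x => θ x • f x) 2 volume ^ 2 := fun f => by
      simp only [hW]; rw [lintegral_enorm_sq_eq_eLpNorm_two_sq]
    simp_rw [e]
    exact ((ENNReal.continuous_pow 2).tendsto _).comp hnorm
  have hWat : W a ≠ ⊤ := by
    rw [hWreal (hintψ (haloc r))]; exact ENNReal.ofReal_ne_top
  -- Claim C proper
  have hC : ∀ {σ : ℝ}, 0 < σ → σ ≤ 1 → σ ≤ T → ∀ t₀ ∈ Ioo 0 σ, W (u t₀) ≤ W a + ρ σ := by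
    intro σ hσ hσ1 hσT' t₀ ht₀
    have ht₀T : t₀ ∈ Icc (0 : ℝ) T := ⟨ht₀.1.le, ht₀.2.le.trans hσT'⟩
    refine ENNReal.le_of_forall_pos_le_add fun δ hδ _ => ?_
    have hδE : (0 : ℝ≥0∞) < δ := by exact_mod_cast hδ
    -- eventually `W(a_{φ k}) ≤ W a + δ`
    have hev1 : ∀ᶠ i in atTop, W (ak (φ i)) ≤ W a + δ := by
      have h := (hWa.comp hφ.tendsto_atTop)
      have hlt : W a < W a + δ := ENNReal.lt_add_right hWat hδE.ne'
      exact (h.eventually (Iio_mem_nhds hlt)).mono fun i hi => hi.le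
    refine lintegral_sq_smul_le_of_tendsto_integral_inner (l := atTop) (v := fun i => v (φ i) t₀) hθtest
      (Eventually.of_forall fun i => (hloc (φ i)).sliceMeasurable t₀ ⟨ht₀.1.le, ht₀.2.le.trans (hσ1.trans (hT1.trans hTℓ))⟩)
      (hθL2 (hmeas t₀ ht₀T) (hur t₀ ht₀T)) ?_ (hpt t₀ ht₀T)
    filter_upwards [hev1] with i hi
    -- `W(v_{φ i}(t₀)) ≤ W(a_{φ i}) + ρ σ ≤ W a + δ + ρ σ`
    have hTi : t₀ ∈ Icc (0 : ℝ) Tℓ := ⟨ht₀.1.le, ht₀.2.le.trans (hσ1.trans (hT1.trans hTℓ))⟩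
    have hvint : Integrable (fun x => ‖v (φ i) t₀ x‖ ^ 2 * ψ x) volume := (hloc (φ i)).integrable_sq_mul hTi hψcd.continuous hψc
    have hreal := hB (φ i) hσ hσ1 t₀ ht₀
    calc W (v (φ i) t₀) = ENNReal.ofReal (∫ x, ‖v (φ i) t₀ x‖ ^ 2 * ψ x) := hWreal hvint
      _ ≤ ENNReal.ofReal ((∫ x, ‖ak (φ i) x‖ ^ 2 * ψ x) + (ρ σ).toReal) := ENNReal.ofReal_le_ofReal hreal
      _ = W (ak (φ i)) + ρ σ := by
          rw [ENNReal.ofReal_add (integral_nonneg fun x => mul_nonneg (sq_nonneg _) (hψ0 x)) ENNReal.toReal_nonneg,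
            ENNReal.ofReal_toReal (hρt σ), hWreal (hakψ (φ i))]
      _ ≤ W a + δ + ρ σ := add_le_add hi le_rfl
      _ = W a + ρ σ + δ := by ring
  ------------------------------------------------------------------
  -- ## Claim D: `∫⟪u(t), ψ a⟫ → ∫ ψ |a|²` as `t → 0⁺`
  ------------------------------------------------------------------
  set ξ : EuclideanSpace ℝ (Fin 3) → EuclideanSpace ℝ (Fin 3) := fun x => ψ x • a x with hξ
  have hξ2 : MemLp ξ 2 volume := by
    have h : MemLp (fun x => θ x • (θ x • a x)) 2 volume :=
      hθL2 (hθc.aestronglyMeasurable.smul ham) ((hθL2 ham (haloc r)).restrict _)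
    refine h.ae_eq (Eventually.of_forall fun x => ?_)
    simp only [hξ, hψ, smul_smul, sq]
  have hξK : ∀ x ∉ closedBall (0 : EuclideanSpace ℝ (Fin 3)) r, ξ x = 0 := fun x hx => by
    have : θ x = 0 := hθvan x fun h => hx (ball_subset_closedBall h)
    simp [hξ, hψ, this]
  have hcontξ : ContinuousOn (fun t => ∫ x, ⟪u t x, ξ x⟫) (Icc 0 T) :=
    continuousOn_integral_inner_of_test_of_unitBall_bound hmeas huC hwc hξ2 (isCompact_closedBall 0 r) hξK
  have hD : Tendsto (fun t => ∫ x, ⟪u t x, ξ x⟫) (𝓝[>] 0) (𝓝 (∫ x, ‖a x‖ ^ 2 * ψ x)) := by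
    have h1 : Tendsto (fun t => ∫ x, ⟪u t x, ξ x⟫) (𝓝[Icc 0 T] 0) (𝓝 (∫ x, ⟪u 0 x, ξ x⟫)) := hcontξ 0 h0
    have e0 : ∫ x, ⟪u 0 x, ξ x⟫ = ∫ x, ‖a x‖ ^ 2 * ψ x := by
      refine integral_congr_ae (hu0.mono fun x hx => ?_)
      show ⟪u 0 x, ξ x⟫ = ‖a x‖ ^ 2 * ψ x
      rw [hx, hξ]
      simp only [real_inner_smul_right, real_inner_self_eq_norm_sq]
      ring
    rw [e0] at h1
    have hle : 𝓝[>] (0 : ℝ) ≤ 𝓝[Icc 0 T] 0 := by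
      rw [← nhdsWithin_inter_of_mem (Ioo_mem_nhdsGT hT)]
      refine nhdsWithin_mono _ ?_
      intro x hx
      simp only [mem_inter_iff, mem_Ioi, mem_Ioo] at hx
      exact ⟨by linarith [hx.1], by linarith [hx.2]⟩
    exact h1.mono_left hle
  ------------------------------------------------------------------
  -- ## conclusion
  ------------------------------------------------------------------
  -- the real weighted error and its bound
  have haint : Integrable (fun x => ‖a x‖ ^ 2 * ψ x) volume := hintψ (haloc r)
  have hkey : ∀ t ∈ Ioo (0 : ℝ) (min (1 / 2) (T / 2)),
      ∫⁻ x in ball d 1, ‖u t x - a x‖ₑ ^ 2 ≤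
        ENNReal.ofReal (2 * ((∫ x, ‖a x‖ ^ 2 * ψ x) - ∫ x, ⟪u t x, ξ x⟫)) + ρ (2 * t) := by
    intro t ht
    have ht2 : t < 1 / 2 := ht.2.trans_le (min_le_left _ _)
    have htT2 : t < T / 2 := ht.2.trans_le (min_le_right _ _)
    have htT : t ∈ Icc (0 : ℝ) T := ⟨ht.1.le, by linarith⟩
    have hσ : 0 < 2 * t := by linarith [ht.1]
    have hCt := hC hσ (by linarith) (by linarith) t ⟨ht.1, by linarith [ht.1]⟩
    -- integrability
    have hut := hur t htT
    have huint : Integrable (fun x => ‖u t x‖ ^ 2 * ψ x) volume := hintψ hut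
    have hdint : Integrable (fun x => ‖u t x - a x‖ ^ 2 * ψ x) volume := hintψ (hut.sub (haloc r))
    have hinner : Integrable (fun x => ⟪u t x, ξ x⟫) volume := by
      have h1 : Integrable (fun x => ⟪u t x, ξ x⟫) (volume.restrict (ball (0 : EuclideanSpace ℝ (Fin 3)) r)) :=
        integrable_inner_of_memLp_two hut (hξ2.restrict _)
      refine (integrableOn_iff_integrable_of_support_subset (s := ball (0 : EuclideanSpace ℝ (Fin 3)) r) ?_).1 h1
      intro x hx
      by_contra hxB
      have : ξ x = 0 := by simp [hξ, hψ, hθvan x hxB]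
      exact hx (by simp [this])
    -- `W(u t) ≤ W a + ρ(2t)` in real form
    have hreal1 : ∫ x, ‖u t x‖ ^ 2 * ψ x ≤ (∫ x, ‖a x‖ ^ 2 * ψ x) + (ρ (2 * t)).toReal := by
      have h := hCt
      rw [hWreal huint, hWreal haint, ← ENNReal.ofReal_toReal (hρt (2 * t)),
        ← ENNReal.ofReal_add (integral_nonneg fun x => mul_nonneg (sq_nonneg _) (hψ0 x)) ENNReal.toReal_nonneg] at h
      exact (ENNReal.ofReal_le_ofReal_iff (add_nonneg (integral_nonneg fun x => mul_nonneg (sq_nonneg _) (hψ0 x)) ENNReal.toReal_nonneg)).1 h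
    -- expand `|u − a|²ψ = |u|²ψ − 2⟪u, ψa⟫ + |a|²ψ`
    have hexp : ∫ x, ‖u t x - a x‖ ^ 2 * ψ x = (∫ x, ‖u t x‖ ^ 2 * ψ x) - 2 * (∫ x, ⟪u t x, ξ x⟫) + ∫ x, ‖a x‖ ^ 2 * ψ x := by
      have e : ∀ x, ‖u t x - a x‖ ^ 2 * ψ x = ‖u t x‖ ^ 2 * ψ x - 2 * ⟪u t x, ξ x⟫ + ‖a x‖ ^ 2 * ψ x := fun x => by
        simp only [hξ, real_inner_smul_right]
        rw [@norm_sub_sq_real]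
        ring
      simp_rw [e]
      have i2 : Integrable (fun x => 2 * ⟪u t x, ξ x⟫) volume := hinner.const_mul 2
      have i1 : Integrable (fun x => ‖u t x‖ ^ 2 * ψ x - 2 * ⟪u t x, ξ x⟫) volume := huint.sub i2
      rw [integral_add i1 haint, integral_sub huint i2, integral_const_mul]
    have hbound : ∫ x, ‖u t x - a x‖ ^ 2 * ψ x ≤ 2 * ((∫ x, ‖a x‖ ^ 2 * ψ x) - ∫ x, ⟪u t x, ξ x⟫) + (ρ (2 * t)).toReal := by
      rw [hexp]; linarith
    -- `∫_{B(d,1)} |u − a|² ≤ ∫ |u − a|² ψ` (`ψ = 1` on `B(d,1)`)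
    calc ∫⁻ x in ball d 1, ‖u t x - a x‖ₑ ^ 2 ≤ ∫⁻ x in ball d 1, ‖θ x • (u t x - a x)‖ₑ ^ 2 := by
          refine setLIntegral_mono' measurableSet_ball fun x hx => ?_
          rw [show θ x = 1 from hθone x hx, one_smul]
      _ ≤ W (fun x => u t x - a x) := setLIntegral_le_lintegral _ _
      _ = ENNReal.ofReal (∫ x, ‖u t x - a x‖ ^ 2 * ψ x) := hWreal hdint
      _ ≤ ENNReal.ofReal (2 * ((∫ x, ‖a x‖ ^ 2 * ψ x) - ∫ x, ⟪u t x, ξ x⟫) + (ρ (2 * t)).toReal) := ENNReal.ofReal_le_ofReal hbound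
      _ ≤ ENNReal.ofReal (2 * ((∫ x, ‖a x‖ ^ 2 * ψ x) - ∫ x, ⟪u t x, ξ x⟫)) + ENNReal.ofReal ((ρ (2 * t)).toReal) := ENNReal.ofReal_add_le
      _ = _ := by rw [ENNReal.ofReal_toReal (hρt _)]
  -- the right-hand side tends to `0`
  have hlim1 : Tendsto (fun t => ENNReal.ofReal (2 * ((∫ x, ‖a x‖ ^ 2 * ψ x) - ∫ x, ⟪u t x, ξ x⟫))) (𝓝[>] 0) (𝓝 0) := by
    have h := (hD.const_sub (∫ x, ‖a x‖ ^ 2 * ψ x)).const_mul 2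
    rw [sub_self, mul_zero] at h
    have h' := ENNReal.tendsto_ofReal h
    rwa [ENNReal.ofReal_zero] at h'
  have hlim2 : Tendsto (fun t : ℝ => ρ (2 * t)) (𝓝[>] 0) (𝓝 0) := by
    refine hρ0.comp ?_
    refine tendsto_nhdsWithin_of_tendsto_nhds_of_eventually_within _ ?_ ?_
    · have h : Tendsto (fun t : ℝ => 2 * t) (𝓝 0) (𝓝 0) :=
        ((continuous_const.mul continuous_id : Continuous fun t : ℝ => 2 * t)).tendsto' 0 0 (by norm_num)
      exact h.mono_left nhdsWithin_le_nhds
    · filter_upwards [self_mem_nhdsWithin] with t ht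
      exact mem_Ioi.2 (mul_pos two_pos (mem_Ioi.1 ht))
  have hlim := hlim1.add hlim2
  rw [add_zero] at hlim
  refine tendsto_of_tendsto_of_tendsto_of_le_of_le' tendsto_const_nhds hlim (Eventually.of_forall fun _ => zero_le) ?_
  filter_upwards [Ioo_mem_nhdsGT (lt_min (by norm_num : (0 : ℝ) < 1 / 2) (half_pos hT))] with t ht
  exact hkey t ht

/-! ### The main theorem -/

set_option maxHeartbeats 12800000 in
/-- **Unit-time existence of local energy solutions for `E̊₃` data** (Lemarié-Rieusset 2016,
Thm. 14.8, proof, Step 2, PDF pp. 521–526; Seregin 2014, App. B §B.5, Thms. 5.9–5.11 with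
(B.5.4)–(B.5.9); Kikuchi–Seregin 2007, §5): every measurable, weakly divergence-free datum `a` with
`sup_{x₀} ∫_{B(x₀,1)} |a|³ < ∞` and `∫_{B(x₀,1)} |a|³ → 0` (`|x₀| → ∞`) is the datum of a local
energy solution of the unit-viscosity Navier–Stokes equations on `ℝ³ × (0, 1)` — hypothesis (h₂)
of `localEnergySolution_extension_of_memE2_of_unitExistence`. Proof: module docstring.
[cite: LemarieRieusset2016, Thm. 14.8 proof Step 2 (PDF pp. 521–526)] [cite: Seregin2014Notes, App. B §B.5 (Thms. 5.9–5.11)] -/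
theorem localEnergySolution_exists_unit_of_memE3 :
    ∀ a : EuclideanSpace ℝ (Fin 3) → EuclideanSpace ℝ (Fin 3), AEStronglyMeasurable a volume →
      IsWeaklyDivFree a →
      (∃ A : ℝ≥0, ∀ x₀ : EuclideanSpace ℝ (Fin 3), ∫⁻ x in ball x₀ 1, ‖a x‖ₑ ^ (3 : ℕ) ≤ A) →
      Tendsto (fun x₀ : EuclideanSpace ℝ (Fin 3) => ∫⁻ x in ball x₀ 1, ‖a x‖ₑ ^ (3 : ℕ))
        (cocompact (EuclideanSpace ℝ (Fin 3))) (𝓝 0) →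
      ∃ (w : ℝ → EuclideanSpace ℝ (Fin 3) → EuclideanSpace ℝ (Fin 3))
        (q : ℝ → EuclideanSpace ℝ (Fin 3) → ℝ), IsLocalEnergySolutionOn 1 1 a w q := by
  intro a ham hdiv hA3 hdecay
  obtain ⟨A, hA⟩ := hA3
  ------------------------------------------------------------------
  -- ## Step 0: constants and the splitting of the datum
  ------------------------------------------------------------------
  obtain ⟨εD, hεD, K, hK, Cg, hD0⟩ := exists_uloc_regular_flow
  obtain ⟨εG, hεG, hGron⟩ := exists_perturbed_energy_gronwall
  set εG' : ℝ≥0∞ := min εG 1 with hεG'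
  have hεG'pos : 0 < εG' := lt_min hεG zero_lt_one
  have hεG'top : εG' ≠ ⊤ := ne_top_of_le_ne_top ENNReal.one_ne_top (min_le_right _ _)
  have hεG'r : 0 < εG'.toReal := ENNReal.toReal_pos hεG'pos.ne' hεG'top
  set ε : ℝ := min εD (εG'.toReal / K) with hεdef
  have hε : 0 < ε := lt_min hεD (div_pos hεG'r hK)
  have hεD' : ε ≤ εD := min_le_left _ _
  have hKε : ENNReal.ofReal (K * ε) ≤ εG := by
    have h1 : K * ε ≤ εG'.toReal := by
      calc K * ε ≤ K * (εG'.toReal / K) := by gcongr; exact min_le_right _ _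
        _ = εG'.toReal := mul_div_cancel₀ _ hK.ne'
    calc ENNReal.ofReal (K * ε) ≤ ENNReal.ofReal εG'.toReal := ENNReal.ofReal_le_ofReal h1
      _ = εG' := ENNReal.ofReal_toReal hεG'top
      _ ≤ εG := min_le_left _ _
  obtain ⟨α, β, hα, hβ, ⟨Cβ, hCβt, hCβ⟩, hconv⟩ := exists_uloc_solenoidal_splitting ham hdiv hA hdecay hε
  set V : ℝ≥0∞ := volume (ball (0 : EuclideanSpace ℝ (Fin 3)) 1) with hV
  have hVt : V ≠ ⊤ := measure_ball_lt_top.ne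
  have haLI : LocallyIntegrable a volume := locallyIntegrable_of_forall_lintegral_ball_cube_le ham ENNReal.coe_ne_top hA
  ------------------------------------------------------------------
  -- ## Step 1: the approximants `v_k` (Leray) and the regular flows `a¹_k`
  ------------------------------------------------------------------
  set ak : ℕ → EuclideanSpace ℝ (Fin 3) → EuclideanSpace ℝ (Fin 3) := fun k => α k + β k with hak
  have hak2 : ∀ k, MemLp (ak k) 2 volume := fun k => (hα k).2.2.2.1.add (hβ k).2.2.2.1
  have hak3 : ∀ k, MemLp (ak k) 3 volume := fun k => (hα k).2.2.1.add (hβ k).2.2.1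
  have hakdiv : ∀ k, IsWeaklyDivFree (ak k) := fun k => (hβ k).2.2.2.2.2
  have hakm : ∀ k, AEStronglyMeasurable (ak k) volume := fun k => (hα k).1.add (hβ k).1
  choose v p hvLH _hvp _hvmeas hpm hp32 hv3 hloc using fun k =>
    exists_isGlobalLerayHopf_and_isLocalEnergySolutionOn one_pos (hak2 k) (hakdiv k)
  have hflow : ∀ k, ∃ (a1 : ℝ → EuclideanSpace ℝ (Fin 3) → EuclideanSpace ℝ (Fin 3)) (π1 pK : ℝ → EuclideanSpace ℝ (Fin 3) → ℝ),
      IsLocalLeraySolutionOn 2 1 (α k) a1 pK ∧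
      (∫⁻ z in Ioo 0 2 ×ˢ (univ : Set (EuclideanSpace ℝ (Fin 3))), ‖pK z.1 z.2‖ₑ ^ (3 / 2 : ℝ) < ⊤) ∧
      IsClassicalNSSolutionOn (Ioo 0 4) 1 0 a1 π1 ∧
      (∃ M : ℝ, 0 < M ∧ ∀ t ∈ Ioo 0 4, ∀ x, ‖a1 t x‖ ≤ M) ∧
      (∃ C : ℝ, 0 ≤ C ∧ ∀ t ∈ Ioo 0 4, ∀ x, Real.sqrt t * ‖fderiv ℝ (a1 t) x‖ ≤ C) ∧
      (∀ t ∈ Ioo 0 4, ∫⁻ x, ‖a1 t x‖ₑ ^ 2 ≤ ENNReal.ofReal (2 * VectorCalculus.kineticEnergy (α k))) ∧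
      (∀ t ∈ Ioo 0 4, ∀ z : EuclideanSpace ℝ (Fin 3),
        eLpNorm (a1 t) 3 (volume.restrict (ball z 1)) ≤ ENNReal.ofReal (K * ε)) ∧
      (∀ t ∈ Ioo 0 4, ∀ x, ‖a1 t x‖ ≤ K * ε * t ^ (-(1 / 2 : ℝ))) ∧
      (∀ x₀ : EuclideanSpace ℝ (Fin 3),
        ∫⁻ z in Ioo 0 2 ×ˢ ball x₀ 1, ENNReal.ofReal (frobeniusNormSq (fderiv ℝ (a1 z.1) z.2)) ≤ Cg) := by
    intro k
    obtain ⟨M, hM⟩ := (hα k).2.1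
    exact hD0 (A := max M 1) (ε := ε) (by positivity) hε hεD' (hα k).1 (fun x => (hM x).trans (le_max_left _ _))
      (hα k).2.2.1 (hα k).2.2.2.1 (hα k).2.2.2.2.1 (hα k).2.2.2.2.2
  choose a1 π1 pK hLK hpK hcl hbdM hgradC henergy hN3 _hdec hgradU using hflow
  -- the local Leray structures of `v_k` on `(0,2)` and their weak gradients
  have hLer : ∀ k, IsLocalLeraySolutionOn 2 1 (ak k) (v k) (p k) := fun k => (hloc k 2 two_pos).isLocalLeraySolutionOn
  choose G hG hGb using fun k => (hLer k).uniformLocalGradient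
  have hLH2 : ∀ k, IsLerayHopfOn 2 1 0 (ak k) (v k) := fun k => (hvLH k).isLerayHopfOn two_pos
  ------------------------------------------------------------------
  -- ## Step 2: the perturbed energy inequality with Grönwall, uniform in `k`
  ------------------------------------------------------------------
  set e2 : ℝ≥0∞ := ENNReal.ofReal (Real.exp 2) with he2
  set e22 : ℝ≥0∞ := ENNReal.ofReal (1 + 2 * Real.exp 2) with he22
  have hβint : ∀ k, ENNReal.ofReal (∫ x, ‖ak k x - α k x‖ ^ 2) ≤ Cβ := by
    intro k
    have e : ∀ x, ak k x - α k x = β k x := fun x => by simp only [hak, Pi.add_apply, add_sub_cancel_left]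
    simp_rw [e]
    have hint : Integrable (fun x => ‖β k x‖ ^ 2) volume := (memLp_two_iff_integrable_sq_norm (hβ k).1).1 (hβ k).2.2.2.1
    rw [ofReal_integral_eq_lintegral_ofReal hint (ae_of_all _ fun x => sq_nonneg _)]
    refine (le_of_eq (lintegral_congr fun x => ?_)).trans (hCβ k)
    rw [← ofReal_norm, ENNReal.ofReal_pow (norm_nonneg _)]
  have hgron : ∀ k,
      (∀ᵐ s ∂(volume.restrict (Ioo (0 : ℝ) 2)), ENNReal.ofReal (∫ x, ‖v k s x - a1 k s x‖ ^ 2) ≤ Cβ * e2) ∧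
      ∫⁻ z in Ioo 0 2 ×ˢ (univ : Set (EuclideanSpace ℝ (Fin 3))),
          ENNReal.ofReal (frobeniusNormSq (G k z.1 z.2 - fderiv ℝ (a1 k z.1) z.2)) ≤ Cβ * e22 := by
    intro k
    obtain ⟨M, hM0, hM⟩ := hbdM k
    obtain ⟨C, hC0, hC⟩ := hgradC k
    have hu2 : ∀ᵐ t ∂(volume.restrict (Ioo (0 : ℝ) 2)), ∫⁻ x, ‖v k t x‖ₑ ^ 2 ≤ ENNReal.ofReal (2 * VectorCalculus.kineticEnergy (ak k)) := by
      filter_upwards [ae_restrict_mem measurableSet_Ioo] with t ht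
      exact (hLH2 k).lintegral_enorm_sq_le zero_le_one ⟨ht.1.le, ht.2.le⟩
    have hdivu : ∀ᵐ t ∂(volume.restrict (Ioo (0 : ℝ) 2)), IsWeaklyDivFree (v k t) := by
      filter_upwards [ae_restrict_mem measurableSet_Ioo] with t ht
      exact (hLH2 k).isWeaklyDivFree_slice ⟨ht.1, ht.2.le⟩
    have h := hGron (T' := 2) (S₀ := 2) (S₂ := 4) (A := M / 2) (C₁ := C / (M / 2)) (u₀ := ak k) (a₀ := α k)
      (u := v k) (a := a1 k) (p := p k) (π := π1 k) (pK := pK k) (G := G k)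
      (Eu := ENNReal.ofReal (2 * VectorCalculus.kineticEnergy (ak k))) (Ea := ENNReal.ofReal (2 * VectorCalculus.kineticEnergy (α k)))
      (N := ENNReal.ofReal (K * ε)) two_pos (hakm k) (hLer k) (hG k) (hGb k) two_pos (by norm_num) (by positivity) (by positivity)
      (hLK k) (hcl k) (fun t ht x => by have := hM t ht x; linarith)
      (fun t ht x => by rw [div_mul_cancel₀ _ (ne_of_gt (half_pos hM0))]; exact hC t ⟨ht.1, ht.2.trans (by norm_num)⟩ x)
      (hα k).1 (hak2 k) (hα k).2.2.2.1 ENNReal.ofReal_ne_top ENNReal.ofReal_ne_top hu2 (fun t ht => henergy k t ht)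
      (hv3 k 2 two_pos) (hp32 k 2 two_pos) (hpK k) hdivu (fun t ht z => hN3 k t ht z) hKε
    rw [min_self] at h
    obtain ⟨h1, h2⟩ := h
    refine ⟨?_, ?_⟩
    · filter_upwards [h1, ae_restrict_mem measurableSet_Ioo] with s hs hsI
      refine hs.trans ?_
      refine mul_le_mul' (hβint k) (ENNReal.ofReal_le_ofReal (Real.exp_le_exp.2 hsI.2.le))
    · exact h2.trans (mul_le_mul' (hβint k) le_rfl)
  ------------------------------------------------------------------
  -- ## Step 3: uniform bounds for the limiting procedure
  ------------------------------------------------------------------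
  -- (a) the gradients
  set Cgrad : ℝ≥0∞ := 2 * (Cg : ℝ≥0∞) + 2 * (Cβ * e22) with hCgrad
  have hCgradt : Cgrad ≠ ⊤ := ENNReal.add_ne_top.2 ⟨ENNReal.mul_ne_top ENNReal.ofNat_ne_top ENNReal.coe_ne_top,
    ENNReal.mul_ne_top ENNReal.ofNat_ne_top (ENNReal.mul_ne_top hCβt.ne ENNReal.ofReal_ne_top)⟩
  have hgradk : ∀ k (x₀ : EuclideanSpace ℝ (Fin 3)),
      ∫⁻ z in Ioo 0 2 ×ˢ ball x₀ 1, ENNReal.ofReal (frobeniusNormSq (G k z.1 z.2)) ≤ Cgrad := by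
    intro k x₀
    have hpt : ∀ z : ℝ × EuclideanSpace ℝ (Fin 3), ENNReal.ofReal (frobeniusNormSq (G k z.1 z.2)) ≤
        2 * ENNReal.ofReal (frobeniusNormSq (fderiv ℝ (a1 k z.1) z.2)) +
          2 * ENNReal.ofReal (frobeniusNormSq (G k z.1 z.2 - fderiv ℝ (a1 k z.1) z.2)) := by
      intro z
      have h := frobeniusNormSq_add_le_two_mul (fderiv ℝ (a1 k z.1) z.2) (G k z.1 z.2 - fderiv ℝ (a1 k z.1) z.2)
      rw [add_sub_cancel] at h
      calc ENNReal.ofReal (frobeniusNormSq (G k z.1 z.2))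
          ≤ ENNReal.ofReal (2 * frobeniusNormSq (fderiv ℝ (a1 k z.1) z.2) + 2 * frobeniusNormSq (G k z.1 z.2 - fderiv ℝ (a1 k z.1) z.2)) :=
            ENNReal.ofReal_le_ofReal h
        _ = _ := by
            rw [ENNReal.ofReal_add (by positivity [frobeniusNormSq_nonneg (fderiv ℝ (a1 k z.1) z.2)])
              (by positivity [frobeniusNormSq_nonneg (G k z.1 z.2 - fderiv ℝ (a1 k z.1) z.2)]),
              ENNReal.ofReal_mul zero_le_two, ENNReal.ofReal_mul zero_le_two, ENNReal.ofReal_ofNat]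
    have hmeasD : AEMeasurable (fun z : ℝ × EuclideanSpace ℝ (Fin 3) => ENNReal.ofReal (frobeniusNormSq (fderiv ℝ (a1 k z.1) z.2)))
        (volume.restrict (Ioo 0 2 ×ˢ ball x₀ 1)) := by
      have hDacont : ContinuousOn (fun z : ℝ × (EuclideanSpace ℝ (Fin 3)) => fderiv ℝ (a1 k z.1) z.2)
          (Ioo 0 4 ×ˢ (univ : Set (EuclideanSpace ℝ (Fin 3)))) :=
        ((hcl k).smooth_velocity.fderiv_slice isOpen_Ioo.uniqueDiffOn).continuousOn
      have hsub : Ioo (0 : ℝ) 2 ×ˢ ball x₀ 1 ⊆ Ioo 0 4 ×ˢ (univ : Set (EuclideanSpace ℝ (Fin 3))) :=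
        Set.prod_mono (Ioo_subset_Ioo_right (by norm_num)) (subset_univ _)
      have hm : AEStronglyMeasurable (fun z : ℝ × (EuclideanSpace ℝ (Fin 3)) => fderiv ℝ (a1 k z.1) z.2)
          (volume.restrict (Ioo (0 : ℝ) 2 ×ˢ ball x₀ 1)) :=
        (hDacont.mono hsub).aestronglyMeasurable (measurableSet_Ioo.prod measurableSet_ball)
      exact (LerayHopfProofs.continuous_frobeniusNormSq.comp_aestronglyMeasurable hm).aemeasurable.ennreal_ofReal
    calc ∫⁻ z in Ioo 0 2 ×ˢ ball x₀ 1, ENNReal.ofReal (frobeniusNormSq (G k z.1 z.2))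
        ≤ ∫⁻ z in Ioo 0 2 ×ˢ ball x₀ 1, (2 * ENNReal.ofReal (frobeniusNormSq (fderiv ℝ (a1 k z.1) z.2)) +
            2 * ENNReal.ofReal (frobeniusNormSq (G k z.1 z.2 - fderiv ℝ (a1 k z.1) z.2))) := lintegral_mono hpt
      _ = 2 * (∫⁻ z in Ioo 0 2 ×ˢ ball x₀ 1, ENNReal.ofReal (frobeniusNormSq (fderiv ℝ (a1 k z.1) z.2))) +
          2 * ∫⁻ z in Ioo 0 2 ×ˢ ball x₀ 1, ENNReal.ofReal (frobeniusNormSq (G k z.1 z.2 - fderiv ℝ (a1 k z.1) z.2)) := by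
          rw [lintegral_add_left' (hmeasD.const_mul _), lintegral_const_mul' _ _ ENNReal.ofNat_ne_top,
            lintegral_const_mul' _ _ ENNReal.ofNat_ne_top]
      _ ≤ 2 * (Cg : ℝ≥0∞) + 2 * (Cβ * e22) :=
          add_le_add (mul_le_mul' le_rfl (hgradU k x₀))
            (mul_le_mul' le_rfl ((lintegral_mono_set (Set.prod_mono Subset.rfl (subset_univ _))).trans (hgron k).2))
  -- (b) the energies at a.e. time
  set Cen : ℝ≥0∞ := 2 * (V ^ (1 / 3 : ℝ) * ENNReal.ofReal (K * ε) ^ 2) + 2 * (Cβ * e2) with hCen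
  have hCent : Cen ≠ ⊤ := ENNReal.add_ne_top.2 ⟨ENNReal.mul_ne_top ENNReal.ofNat_ne_top
    (ENNReal.mul_ne_top (ENNReal.rpow_ne_top_of_nonneg (by norm_num) hVt) (ENNReal.pow_ne_top ENNReal.ofReal_ne_top)),
    ENNReal.mul_ne_top ENNReal.ofNat_ne_top (ENNReal.mul_ne_top hCβt.ne ENNReal.ofReal_ne_top)⟩
  have henk : ∀ k, ∀ᵐ t ∂(volume.restrict (Ioo (0 : ℝ) 2)), ∀ x₀ : EuclideanSpace ℝ (Fin 3),
      ∫⁻ x in ball x₀ 1, ‖v k t x‖ₑ ^ 2 ≤ Cen := by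
    intro k
    filter_upwards [(hgron k).1, ae_restrict_mem measurableSet_Ioo] with t ht htI x₀
    have ht4 : t ∈ Ioo (0 : ℝ) 4 := ⟨htI.1, htI.2.trans (by norm_num)⟩
    have hat : AEStronglyMeasurable (a1 k t) volume := ((hcl k).contDiff_velocity ht4).continuous.aestronglyMeasurable
    have hvt2 : MemLp (v k t) 2 volume := (hLH2 k).memLp t ⟨htI.1.le, htI.2.le⟩
    have hat2 : MemLp (a1 k t) 2 volume := by
      refine ⟨hat, ?_⟩
      rw [eLpNorm_two_eq_rpow_lintegral_sq]
      refine ENNReal.rpow_lt_top_of_nonneg (by norm_num) ((henergy k t ht4).trans_lt ENNReal.ofReal_lt_top).ne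
    -- `∫ |v - a¹|² ≤ Cβ e²`
    have hw2 : ∫⁻ x, ‖v k t x - a1 k t x‖ₑ ^ 2 ≤ Cβ * e2 := by
      have hint : Integrable (fun x => ‖v k t x - a1 k t x‖ ^ 2) volume :=
        (memLp_two_iff_integrable_sq_norm (hvt2.sub hat2).1).1 (hvt2.sub hat2)
      have e : ∫⁻ x, ‖v k t x - a1 k t x‖ₑ ^ 2 = ENNReal.ofReal (∫ x, ‖v k t x - a1 k t x‖ ^ 2) := by
        rw [ofReal_integral_eq_lintegral_ofReal hint (ae_of_all _ fun x => sq_nonneg _)]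
        refine lintegral_congr fun x => ?_
        rw [← ofReal_norm, ENNReal.ofReal_pow (norm_nonneg _)]
      rw [e]; exact ht
    -- `∫_B |a¹|² ≤ V^{1/3} (Kε)²`
    have ha2 : ∫⁻ x in ball x₀ 1, ‖a1 k t x‖ₑ ^ 2 ≤ V ^ (1 / 3 : ℝ) * ENNReal.ofReal (K * ε) ^ 2 :=
      (lintegral_unitBall_sq_le_eLpNorm_three_ball hat x₀).trans (mul_le_mul' le_rfl (pow_le_pow_left' (hN3 k t ht4 x₀) 2))
    calc ∫⁻ x in ball x₀ 1, ‖v k t x‖ₑ ^ 2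
        ≤ ∫⁻ x in ball x₀ 1, (2 * ‖a1 k t x‖ₑ ^ 2 + 2 * ‖v k t x - a1 k t x‖ₑ ^ 2) := by
          refine lintegral_mono fun x => ?_
          have e : v k t x = a1 k t x + (v k t x - a1 k t x) := by abel
          calc ‖v k t x‖ₑ ^ 2 = ‖a1 k t x + (v k t x - a1 k t x)‖ₑ ^ 2 := by rw [← e]
            _ ≤ (‖a1 k t x‖ₑ + ‖v k t x - a1 k t x‖ₑ) ^ 2 := by gcongr; exact enorm_add_le _ _
            _ ≤ 2 * ‖a1 k t x‖ₑ ^ 2 + 2 * ‖v k t x - a1 k t x‖ₑ ^ 2 := ennreal_add_sq_le _ _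
      _ = 2 * (∫⁻ x in ball x₀ 1, ‖a1 k t x‖ₑ ^ 2) + 2 * ∫⁻ x in ball x₀ 1, ‖v k t x - a1 k t x‖ₑ ^ 2 := by
          rw [lintegral_add_left' ((hat.enorm.pow_const _).restrict.const_mul _), lintegral_const_mul' _ _ ENNReal.ofNat_ne_top,
            lintegral_const_mul' _ _ ENNReal.ofNat_ne_top]
      _ ≤ 2 * (V ^ (1 / 3 : ℝ) * ENNReal.ofReal (K * ε) ^ 2) + 2 * (Cβ * e2) :=
          add_le_add (mul_le_mul' le_rfl ha2) (mul_le_mul' le_rfl ((setLIntegral_le_lintegral _ _).trans hw2))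
  -- (c) the constant of the limiting procedure and the every-time bound on `[0, 3/2]`
  set Cfin : ℝ≥0 := (max Cen Cgrad).toNNReal with hCfin
  have hCfinE : (Cfin : ℝ≥0∞) = max Cen Cgrad := ENNReal.coe_toNNReal (by simp [hCent, hCgradt])
  have hT32 : (0 : ℝ) < 3 / 2 := by norm_num
  have hloc32 : ∀ k, IsLocalEnergySolutionOn (3 / 2) 1 (ak k) (v k) (p k) := fun k => (hloc k 2 two_pos).mono (by norm_num)
  have hCk : ∀ k, ∀ t ∈ Icc (0 : ℝ) (3 / 2), ∀ x₀ : EuclideanSpace ℝ (Fin 3), ∫⁻ x in ball x₀ 1, ‖v k t x‖ₑ ^ 2 ≤ Cfin := by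
    intro k t ht x₀
    rw [hCfinE]
    refine le_trans ?_ (le_max_left _ _)
    refine (hloc k 2 two_pos).lintegral_ball_le_of_ae ⟨ht.1, ht.2.trans (by norm_num)⟩ (ht.2.trans_lt (by norm_num)) le_rfl x₀ ?_
    have h := (ae_restrict_iff' (measurableSet_Ioo : MeasurableSet (Ioo (0 : ℝ) 2))).1 (henk k)
    filter_upwards [h] with s hs hsI
    exact hs ⟨ht.1.trans_lt hsI.1, hsI.2⟩ x₀
  have hGk : ∀ k, ∃ G' : ℝ → EuclideanSpace ℝ (Fin 3) → EuclideanSpace ℝ (Fin 3) →L[ℝ] EuclideanSpace ℝ (Fin 3),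
      HasWeakSpatialGradientOn (slab (EuclideanSpace ℝ (Fin 3)) (Ioo 0 (3 / 2)) isOpen_Ioo) (v k) G' ∧
        ∀ x₀ : EuclideanSpace ℝ (Fin 3), ∫⁻ z in Ioo 0 (3 / 2) ×ˢ ball x₀ 1, ENNReal.ofReal (frobeniusNormSq (G' z.1 z.2)) ≤ Cfin := by
    intro k
    refine ⟨G k, (hG k).mono (slab_mono (Ioo_subset_Ioo_right (by norm_num))), fun x₀ => ?_⟩
    rw [hCfinE]
    exact ((lintegral_mono_set (Set.prod_mono (Ioo_subset_Ioo_right (by norm_num)) Subset.rfl)).trans (hgradk k x₀)).trans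
      (le_max_right _ _)
  ------------------------------------------------------------------
  -- ## Step 4: the limiting procedure on `[0, 3/2]`
  ------------------------------------------------------------------
  obtain ⟨φ, u, q, c, hφ, hc, hsuit, hq, hmeas, huC, huG, hL2, hL3, hunif, hpress⟩ :=
    seregin2014_localEnergy_limitingProcedure_holds one_pos hT32 Cfin ak v p hloc32 hCk hGk
  have hpt : ∀ t ∈ Icc (0 : ℝ) (3 / 2), ∀ ψ : EuclideanSpace ℝ (Fin 3) → EuclideanSpace ℝ (Fin 3),
      FunctionSpaces.IsTestFunctionOn (⊤ : Opens (EuclideanSpace ℝ (Fin 3))) ψ →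
        Tendsto (fun k => ∫ x, ⟪v (φ k) t x, ψ x⟫) atTop (𝓝 (∫ x, ⟪u t x, ψ x⟫)) :=
    fun t ht ψ hψ => (hunif ψ hψ).tendsto_at ht
  have h0 : (0 : ℝ) ∈ Icc (0 : ℝ) (3 / 2) := ⟨le_rfl, hT32.le⟩
  -- weak continuity of the limit
  have hwc : ∀ ψ : EuclideanSpace ℝ (Fin 3) → EuclideanSpace ℝ (Fin 3),
      FunctionSpaces.IsTestFunctionOn (⊤ : Opens (EuclideanSpace ℝ (Fin 3))) ψ →
        ContinuousOn (fun t => ∫ x, ⟪u t x, ψ x⟫) (Icc 0 (3 / 2)) := fun ψ hψ =>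
    (hunif ψ hψ).continuousOn (Frequently.of_forall fun k => (hloc32 (φ k)).weakContinuous ψ hψ)
  ------------------------------------------------------------------
  -- ## Step 5: the datum of the limit is `a`
  ------------------------------------------------------------------
  have hakloc : ∀ k (ρ : ℝ), MemLp (ak k) 2 (volume.restrict (ball (0 : EuclideanSpace ℝ (Fin 3)) ρ)) :=
    fun k ρ => (hak2 k).restrict _
  have haloc : ∀ ρ : ℝ, MemLp a 2 (volume.restrict (ball (0 : EuclideanSpace ℝ (Fin 3)) ρ)) := fun ρ =>
    (memLp_indicator_iff_restrict measurableSet_ball).1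
      (memLp_indicator_ball_of_forall_lintegral_ball_cube_le ham ENNReal.coe_ne_top hA ρ (by norm_num))
  have hconvA : ∀ ψ : EuclideanSpace ℝ (Fin 3) → EuclideanSpace ℝ (Fin 3),
      FunctionSpaces.IsTestFunctionOn (⊤ : Opens (EuclideanSpace ℝ (Fin 3))) ψ →
        Tendsto (fun k => ∫ x, ⟪ak k x, ψ x⟫) atTop (𝓝 (∫ x, ⟪a x, ψ x⟫)) := fun ψ hψ =>
    tendsto_integral_inner_of_tendsto_lintegral_ball hakloc haloc
      (fun ρ hρ => by simpa only [hak, Pi.add_apply] using hconv ρ hρ) hψ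
  have hconv0 : ∀ ψ : EuclideanSpace ℝ (Fin 3) → EuclideanSpace ℝ (Fin 3),
      FunctionSpaces.IsTestFunctionOn (⊤ : Opens (EuclideanSpace ℝ (Fin 3))) ψ →
        Tendsto (fun k => ∫ x, ⟪ak (φ k) x, ψ x⟫) atTop (𝓝 (∫ x, ⟪u 0 x, ψ x⟫)) := by
    intro ψ hψ
    have e : ∀ k, ∫ x, ⟪ak (φ k) x, ψ x⟫ = ∫ x, ⟪v (φ k) 0 x, ψ x⟫ := fun k =>
      ((hloc32 (φ k)).integral_inner_zero_eq hT32 ((hak2 (φ k)).locallyIntegrable (by norm_num)) hψ).symm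
    simp_rw [e]
    exact hpt 0 h0 ψ hψ
  have hu0 : u 0 =ᵐ[volume] a := by
    have hu0LI : LocallyIntegrable (u 0) volume := LocalLerayLimit.locallyIntegrable_of_bound (hmeas 0 h0) (huC 0 h0)
    exact FunctionSpaces.ae_eq_of_forall_integral_inner_test_eq hu0LI haLI fun ψ hψ =>
      tendsto_nhds_unique (hconv0 ψ hψ) ((hconvA ψ hψ).comp hφ.tendsto_atTop)
  ------------------------------------------------------------------
  -- ## Step 6: the initial condition `∫_K |u(t) − a|² → 0`
  ------------------------------------------------------------------
  -- the data in `L²_uloc`, uniformly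
  set Cdat : ℝ≥0∞ := 2 * (V ^ (1 / 3 : ℝ) * ENNReal.ofReal ε ^ 2) + 2 * Cβ with hCdat
  have hCdatt : Cdat ≠ ⊤ := ENNReal.add_ne_top.2 ⟨ENNReal.mul_ne_top ENNReal.ofNat_ne_top
    (ENNReal.mul_ne_top (ENNReal.rpow_ne_top_of_nonneg (by norm_num) hVt) (ENNReal.pow_ne_top ENNReal.ofReal_ne_top)),
    ENNReal.mul_ne_top ENNReal.ofNat_ne_top hCβt.ne⟩
  have hdat : ∀ k (x₀ : EuclideanSpace ℝ (Fin 3)), ∫⁻ x in ball x₀ 1, ‖ak k x‖ₑ ^ 2 ≤ Cdat := by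
    intro k x₀
    have hα2 : ∫⁻ x in ball x₀ 1, ‖α k x‖ₑ ^ 2 ≤ V ^ (1 / 3 : ℝ) * ENNReal.ofReal ε ^ 2 :=
      (lintegral_unitBall_sq_le_eLpNorm_three_ball (hα k).1 x₀).trans (mul_le_mul' le_rfl (pow_le_pow_left' ((hα k).2.2.2.2.2 x₀) 2))
    have hβ2 : ∫⁻ x in ball x₀ 1, ‖β k x‖ₑ ^ 2 ≤ Cβ :=
      (setLIntegral_le_lintegral _ _).trans ((le_of_eq (lintegral_congr fun x => by norm_cast)).trans (hCβ k))
    calc ∫⁻ x in ball x₀ 1, ‖ak k x‖ₑ ^ 2 ≤ ∫⁻ x in ball x₀ 1, (2 * ‖α k x‖ₑ ^ 2 + 2 * ‖β k x‖ₑ ^ 2) := by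
          refine lintegral_mono fun x => ?_
          calc ‖ak k x‖ₑ ^ 2 = ‖α k x + β k x‖ₑ ^ 2 := rfl
            _ ≤ (‖α k x‖ₑ + ‖β k x‖ₑ) ^ 2 := by gcongr; exact enorm_add_le _ _
            _ ≤ 2 * ‖α k x‖ₑ ^ 2 + 2 * ‖β k x‖ₑ ^ 2 := ennreal_add_sq_le _ _
      _ = 2 * (∫⁻ x in ball x₀ 1, ‖α k x‖ₑ ^ 2) + 2 * ∫⁻ x in ball x₀ 1, ‖β k x‖ₑ ^ 2 := by
          rw [lintegral_add_left' (((hα k).1.enorm.pow_const _).restrict.const_mul _), lintegral_const_mul' _ _ ENNReal.ofNat_ne_top,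
            lintegral_const_mul' _ _ ENNReal.ofNat_ne_top]
      _ ≤ Cdat := add_le_add (mul_le_mul' le_rfl hα2) (mul_le_mul' le_rfl hβ2)
  have hinit : ∀ K : Set (EuclideanSpace ℝ (Fin 3)), IsCompact K →
      Tendsto (fun t => ∫⁻ x in K, ‖u t x - a x‖ₑ ^ 2) (𝓝[>] 0) (𝓝 0) := by
    intro K hK
    have hcentre : ∀ d : EuclideanSpace ℝ (Fin 3), Tendsto (fun t => ∫⁻ x in ball d 1, ‖u t x - a x‖ₑ ^ 2) (𝓝[>] 0) (𝓝 0) :=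
      fun d => tendsto_lintegral_ball_sub_sq_of_uniform_bounds (Tℓ := 2) (T := 3 / 2) hT32 (by norm_num) (by norm_num) hφ
        (fun k => hloc k 2 two_pos) hakm hakdiv hpm hG hCent hCgradt hCdatt henk hgradk hdat hakloc ham haloc
        (fun ρ hρ => by simpa only [hak, Pi.add_apply] using hconv ρ hρ) hmeas huC hwc hpt hu0 d
    obtain ⟨R, hR⟩ := hK.isBounded.subset_ball (0 : EuclideanSpace ℝ (Fin 3))
    obtain ⟨F, hF⟩ := exists_finset_ball_subset_biUnion_ball_one R
    have hsum : Tendsto (fun t => ∑ d ∈ F, ∫⁻ x in ball ((0 : EuclideanSpace ℝ (Fin 3)) + d) 1, ‖u t x - a x‖ₑ ^ 2) (𝓝[>] 0) (𝓝 0) := by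
      have h := tendsto_finsetSum F fun d _ => hcentre ((0 : EuclideanSpace ℝ (Fin 3)) + d)
      rwa [Finset.sum_const_zero] at h
    have hcard : Tendsto (fun t => (F.card : ℝ≥0∞) * ∑ d ∈ F, ∫⁻ x in ball ((0 : EuclideanSpace ℝ (Fin 3)) + d) 1, ‖u t x - a x‖ₑ ^ 2)
        (𝓝[>] 0) (𝓝 0) := by
      have h := ENNReal.Tendsto.const_mul hsum (a := (F.card : ℝ≥0∞)) (Or.inr (ENNReal.natCast_ne_top _))
      rwa [mul_zero] at h
    refine tendsto_of_tendsto_of_tendsto_of_le_of_le tendsto_const_nhds hcard (fun _ => zero_le) fun t => ?_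
    calc ∫⁻ x in K, ‖u t x - a x‖ₑ ^ 2 ≤ ∫⁻ x in ⋃ d ∈ F, ball ((0 : EuclideanSpace ℝ (Fin 3)) + d) 1, ‖u t x - a x‖ₑ ^ 2 :=
          lintegral_mono_set (hR.trans (hF 0))
      _ ≤ F.card * ∑ d ∈ F, ∫⁻ x in ball ((0 : EuclideanSpace ℝ (Fin 3)) + d) 1, ‖u t x - a x‖ₑ ^ 2 :=
          lintegral_biUnion_finset_le_card_mul F _ _ fun d hd =>
            Finset.single_le_sum (f := fun d => ∫⁻ x in ball ((0 : EuclideanSpace ℝ (Fin 3)) + d) 1, ‖u t x - a x‖ₑ ^ 2)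
              (fun _ _ => zero_le) hd
  ------------------------------------------------------------------
  -- ## Step 7: pressure expansion and decay of the limit (as in the tree's compactness template)
  ------------------------------------------------------------------
  set w : ℕ → ℝ → EuclideanSpace ℝ (Fin 3) → EuclideanSpace ℝ (Fin 3) := fun k => v (φ k) with hw_def
  set qg : ℕ → ℝ → EuclideanSpace ℝ (Fin 3) → ℝ := fun k t x => p (φ k) t x - c k t with hqg_def
  have hw : ∀ k, IsLocalLeraySolutionOn (3 / 2) 1 (ak (φ k)) (w k) (qg k) := fun k =>
    (hloc32 (φ k)).isLocalLeraySolutionOn_sub_gauge (hc k).1 (hc k).2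
  have hwC : ∀ k, ∀ᵐ t ∂(volume.restrict (Ioo (0 : ℝ) (3 / 2))),
      ∀ x₀ : EuclideanSpace ℝ (Fin 3), ∫⁻ y in ball x₀ 1, ‖w k t y‖ₑ ^ 2 ≤ Cfin := fun k =>
    (ae_restrict_mem measurableSet_Ioo).mono fun t ht x₀ => hCk (φ k) t ⟨ht.1.le, ht.2.le⟩ x₀
  have huA : ∀ᵐ t ∂(volume.restrict (Ioo (0 : ℝ) (3 / 2))),
      ∀ x₀ : EuclideanSpace ℝ (Fin 3), ∫⁻ y in ball x₀ 1, ‖u t y‖ₑ ^ 2 ≤ Cfin :=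
    (ae_restrict_mem measurableSet_Ioo).mono fun t ht x₀ => huC t ⟨ht.1.le, ht.2.le⟩ x₀
  have hpl : LocallyIntegrableOn (uncurry q) (Ioo (0 : ℝ) (3 / 2) ×ˢ (univ : Set (EuclideanSpace ℝ (Fin 3)))) volume :=
    hsuit.distributional.2.2.1
  have hum : AEStronglyMeasurable (uncurry u) (volume.restrict (Ioo (0 : ℝ) (3 / 2) ×ˢ (univ : Set (EuclideanSpace ℝ (Fin 3))))) :=
    hsuit.distributional.1.aestronglyMeasurable
  have hqm : AEStronglyMeasurable (uncurry q) (volume.restrict (Ioo (0 : ℝ) (3 / 2) ×ˢ (univ : Set (EuclideanSpace ℝ (Fin 3))))) :=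
    hpl.aestronglyMeasurable
  have hu3 : ∀ R : ℝ, 0 < R → ∫⁻ z in Ioo 0 (3 / 2) ×ˢ ball (0 : EuclideanSpace ℝ (Fin 3)) R, ‖u z.1 z.2‖ₑ ^ (3 : ℕ) < ∞ := by
    intro R hR
    obtain ⟨k, hk⟩ := ((hL3 R hR).eventually (gt_mem_nhds (zero_lt_one' ℝ≥0∞))).exists
    have h3k : ∫⁻ z in Ioo 0 (3 / 2) ×ˢ ball (0 : EuclideanSpace ℝ (Fin 3)) R, ‖w k z.1 z.2‖ₑ ^ (3 : ℕ) < ∞ :=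
      (hw k).lintegral_cube_box_lt_top 0 R
    set μB : Measure (ℝ × EuclideanSpace ℝ (Fin 3)) := volume.restrict (Ioo 0 (3 / 2) ×ˢ ball (0 : EuclideanSpace ℝ (Fin 3)) R) with hμB
    have hμB : μB ≤ volume.restrict (Ioo (0 : ℝ) (3 / 2) ×ˢ (univ : Set (EuclideanSpace ℝ (Fin 3)))) :=
      Measure.restrict_mono (prod_mono Subset.rfl (subset_univ _)) le_rfl
    have hwe : AEMeasurable (fun z : ℝ × EuclideanSpace ℝ (Fin 3) => ‖w k z.1 z.2‖ₑ ^ (3 : ℕ)) μB :=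
      (((hw k).aestronglyMeasurable.mono_measure hμB).enorm.pow_const _)
    have hde : AEMeasurable (fun z : ℝ × EuclideanSpace ℝ (Fin 3) => ‖w k z.1 z.2 - u z.1 z.2‖ₑ ^ (3 : ℕ)) μB :=
      ((((hw k).aestronglyMeasurable.sub hum).mono_measure hμB).enorm.pow_const _)
    have hpt3 : ∀ z : ℝ × EuclideanSpace ℝ (Fin 3), ‖u z.1 z.2‖ₑ ^ (3 : ℕ) ≤
        (2 : ℝ≥0∞) ^ ((3 : ℝ) - 1) * (‖w k z.1 z.2‖ₑ ^ (3 : ℕ) + ‖w k z.1 z.2 - u z.1 z.2‖ₑ ^ (3 : ℕ)) := by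
      intro z
      have hsub : ‖u z.1 z.2‖ₑ ≤ ‖w k z.1 z.2‖ₑ + ‖w k z.1 z.2 - u z.1 z.2‖ₑ := by
        have e : u z.1 z.2 = w k z.1 z.2 - (w k z.1 z.2 - u z.1 z.2) := by rw [sub_sub_cancel]
        calc ‖u z.1 z.2‖ₑ = ‖w k z.1 z.2 - (w k z.1 z.2 - u z.1 z.2)‖ₑ := by rw [← e]
          _ ≤ ‖w k z.1 z.2‖ₑ + ‖w k z.1 z.2 - u z.1 z.2‖ₑ := enorm_sub_le
      have h := ENNReal.rpow_add_le_mul_rpow_add_rpow (‖w k z.1 z.2‖ₑ) (‖w k z.1 z.2 - u z.1 z.2‖ₑ) (by norm_num : (1 : ℝ) ≤ 3)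
      rw [show ((3 : ℝ)) = ((3 : ℕ) : ℝ) by norm_num, ENNReal.rpow_natCast, ENNReal.rpow_natCast, ENNReal.rpow_natCast] at h
      exact (pow_le_pow_left' hsub 3).trans (by exact_mod_cast h)
    calc ∫⁻ z in Ioo 0 (3 / 2) ×ˢ ball (0 : EuclideanSpace ℝ (Fin 3)) R, ‖u z.1 z.2‖ₑ ^ (3 : ℕ)
        ≤ ∫⁻ z in Ioo 0 (3 / 2) ×ˢ ball (0 : EuclideanSpace ℝ (Fin 3)) R, (2 : ℝ≥0∞) ^ ((3 : ℝ) - 1) *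
            (‖w k z.1 z.2‖ₑ ^ (3 : ℕ) + ‖w k z.1 z.2 - u z.1 z.2‖ₑ ^ (3 : ℕ)) := lintegral_mono hpt3
      _ = (2 : ℝ≥0∞) ^ ((3 : ℝ) - 1) *
            ((∫⁻ z in Ioo 0 (3 / 2) ×ˢ ball (0 : EuclideanSpace ℝ (Fin 3)) R, ‖w k z.1 z.2‖ₑ ^ (3 : ℕ)) +
              ∫⁻ z in Ioo 0 (3 / 2) ×ˢ ball (0 : EuclideanSpace ℝ (Fin 3)) R, ‖w k z.1 z.2 - u z.1 z.2‖ₑ ^ (3 : ℕ)) := by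
          have hsum : AEMeasurable (fun z : ℝ × EuclideanSpace ℝ (Fin 3) =>
              ‖w k z.1 z.2‖ₑ ^ (3 : ℕ) + ‖w k z.1 z.2 - u z.1 z.2‖ₑ ^ (3 : ℕ)) μB := hwe.add hde
          rw [lintegral_const_mul'' _ hsum, lintegral_add_left' hwe]
      _ < ∞ := ENNReal.mul_lt_top (ENNReal.rpow_lt_top_of_nonneg (by norm_num) ENNReal.ofNat_ne_top)
          (ENNReal.add_lt_top.2 ⟨h3k, hk.trans ENNReal.one_lt_top⟩)
  have hF := fun (δ : ℝ) (hδ : 0 < δ) (η' : ℝ → ℝ) (hη' : ContDiff ℝ (⊤ : ℕ∞) η')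
      (hη'c : HasCompactSupport η') (hη'T : tsupport η' ⊆ Ioo 0 (3 / 2)) (c₀ e : EuclideanSpace ℝ (Fin 3)) =>
    Seregin2014Limit.limit_pgFunctional_eq_zero Cfin hw hwC hpl hum huA hL2 hpress hδ hη' hη'c hη'T c₀ e
  have hexp := Seregin2014Limit.limit_ae_slice_pressure_expansion hum hqm hq ENNReal.coe_ne_top huA hu3 hF
  have hdecayL := seregin2014_limit_decay_holds one_pos hT32 Cfin a u q (memE2_of_uloc_cube ham hA hdecay) hdiv hsuit
    hq hmeas huC huG hwc hinit (fun x₀ r hr => hexp.mono fun t ht => ht x₀ r hr)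
  ------------------------------------------------------------------
  -- ## Step 8: the local energy solution on `[0, 3/2]`, restricted to `[0, 1]`
  ------------------------------------------------------------------
  have hsol : IsLocalEnergySolutionOn (3 / 2) 1 a u q :=
    { suitable := hsuit
      pressure := hq
      sliceMeasurable := hmeas
      uniformLocalEnergy := ⟨Cfin, huC⟩
      uniformLocalGradient := huG.imp fun G' hG' => ⟨hG'.1, Cfin, hG'.2⟩
      weakContinuous := hwc
      initial := hinit
      decay := hdecayL }
  exact ⟨u, q, hsol.mono (by norm_num)⟩
end Literature.Analysis.FluidPDE
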